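import Mathlib.Logic.Relation
import Mathlib.Algebra.BigOperators.Group.Multiset.Basic
import Mathlib.Algebra.Module.Pi
import Literature.Computability.AlgebraicComplexity.MatrixMultiplicationExponent
import Literature.Computability.AlgebraicComplexity.FlipGraphMoves
import HarnessLib

/-!
# Kauers–Moosbauer flip graphs: the graph (Def. 8), splits, and weak connectivity (Thm. 9)

Topic `Literature/Computability/AlgebraicComplexity`; companion of `FlipGraphMoves.lean` (KM Def. 2,
Prop. 3, Def. 4 as identities on indexed families) and `FlipCompleteness.lean` (KM Lemma 5, 6,
Thm. 7, Cor. 10). Source: M. Kauers, J. Moosbauer, *Flip Graphs for Matrix Multiplication*,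
Proc. ISSAC 2023, 381–388 = arXiv:2212.01175 (KM), §2–§3. Everything here is PROVED; there are no
named facts.

## The reading of "scheme" (KM Def. 1) used for the graph

KM: "An `(n,m,p)`-matrix multiplication scheme is a finite set `S` of rank-one tensors whose sum is
`M_{n,m,p}`. We call `|S|` the rank of the scheme", rank-one tensors being "non-zero tensors that can
be written as `A ⊗ B ⊗ Γ`". Here a scheme of a 3-tensor `t : ι → κ → μ → K` (coordinates of
`MatrixMultiplicationExponent.lean`: `triad a b c = a ⊗ b ⊗ c`, `matMulTensor K k m n = ⟨k,m,n⟩`) is a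
finite MULTISET `S` of non-zero rank-one tensors with `S.sum = t` (`Scheme t`); its rank is `card S`.
A KM scheme is exactly a `Scheme` without repeated elements. The multiset reading is the one under
which KM's constructions are literally correct: the reduction of Prop. 3 and the split of §3 produce
families in which an element may coincide with another one (KM: "A split produces a correct matrix
multiplication scheme as long as the original scheme does not already contain any of the newly added
elements"), and a SET would then no longer sum to `t`. As in `FlipGraphMoves.lean`, the letters
`A, B, Γ` name the three slots POSITIONALLY (`triad a b c = A ⊗ B ⊗ Γ`); KM's "analogously for any
permutation of `A`, `B` and `Γ`" is implemented by transporting the written-out case along the slot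
permutations `sw₁₂`, `sw₂₃`, `sw₁₃`, `cyc`, `cyc₂` of 3-tensors.

## Contents

* `RedBase S S'` — **KM Prop. 3's construction verbatim** (the case written out: `A` spans a line,
  `B` dependent, `Γ` modified) as a relation between multisets of tensors: `S = {A₀⊗B₀⊗Γ₀} + {Aᵢ⊗Bᵢ⊗Γᵢ}ᵢ + R`
  with `A₀ = αᵢ Aᵢ`, `B₀ = Σᵢ βᵢ Bᵢ`, and `S' = {Aᵢ⊗Bᵢ⊗(Γᵢ + αᵢβᵢΓ₀)}ᵢ + R`, the modified elements that
  vanish being dropped (they are not rank-one tensors, Def. 1); `Reduces` — "`S'` is a reduction of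
  `S`" (KM, after Prop. 3), all six cases of Def. 2; `RedBase.sum_eq` — the construction keeps the sum
  (the computation in the proof of Prop. 3); `Reduces.card_lt` — "a reduction always leads to a vertex
  belonging to a lower level" (KM after Def. 8).
* `FlipBase S S'`, `Flips` — **KM Def. 4** ("`S'` is a flip of `S`") on multisets, the written case
  (shared `A`, `T ∈ {A⊗B⊗Γ', A⊗B'⊗Γ}`) and its transports; `Flips.sum_eq` ("maps a correct scheme to
  another correct scheme"), `Flips.card_eq` ("flips always connect vertices belonging to the same level").
* `Scheme t`, `Scheme.rank`, `Adj` = `E₁ ∪ E₂`, `level` — **KM Def. 8** with vertices the schemes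
  themselves; `AdjQuot` — the same graph on the classes of ANY equivalence relation on schemes (KM's
  vertices are the orbits under the symmetry group of `M_{n,m,p}`; weak connectivity descends to every
  quotient, `eqvGen_adjQuot`, so the symmetry group is not needed for Thm. 9).
* Splits (KM §3, before Thm. 9): `reduces_of_split₃`, `reduces_of_split₂` — "given a scheme `S`
  containing `A⊗B⊗Γ`, we can replace this tensor by the two tensors `A⊗B⊗(Γ−Γ')` and `A⊗B⊗Γ'` … The
  result is a scheme that admits a reduction to `S`" (and the same for `B`).
* `stdScheme t` — the scheme `{t(·,y,z) ⊗ e_y ⊗ e_z : t(·,y,z) ≠ 0}`; for `t = ⟨k,m,n⟩` this is the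
  standard algorithm `{e_{κν} ⊗ e_{κμ} ⊗ e_{μν}}` of rank `k·m·n` (`stdElts_matMulTensor`,
  `rank_stdScheme_matMulTensor`).
* §6: the *plus-transition* of Moosbauer–Poole 2025 (Def. 3), `(A−A')⊗B⊗C, A'⊗B⊗(C+C'),
  A'⊗(B'−B)⊗C'` in place of any two elements, = "an inverse reduction followed by a flip"
  (`triad_add_triad_eq_plusTransition`, `plusTransition_eq_split_then_flip`).
* §7–§8: `Reduces.sum_eq`, `Flips.sum_eq` (all slot cases keep the sum), and **Prop. 3 as an
  edge**: a scheme presented by a `Reducible` family (Def. 2, `FlipGraphMoves.lean`) has an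
  `E₂`-neighbour of smaller rank (`exists_reduces_of_reducible`, `exists_adj_rank_lt_of_reducible`;
  core construction `exists_redBase_of_caseAB`).
* **KM Thm. 9** `kauersMoosbauer2023_thm9`: for every `k m n`, the `(k,m,n)`-flip graph is weakly
  connected — any two schemes of `⟨k,m,n⟩` over a field are joined in the equivalence closure of `Adj`
  (`Relation.EqvGen Adj`), and likewise in every quotient (`kauersMoosbauer2023_thm9_quot`). Proved, as
  printed, by walking every scheme to the standard algorithm with splits and reductions only
  (`eqvGen_adj_stdScheme`, stated for an arbitrary tensor `t` over finite index types).

## Faithfulness notes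

* Def. 8's vertex set is the set of ORBITS of schemes under the symmetry group; edges between orbits
  are induced by edges between representatives. Connectivity of the graph on schemes implies
  connectivity of the induced graph on the classes of any equivalence relation (`eqvGen_adjQuot`), in
  particular on orbits; Thm. 9 is therefore stated on schemes and on an arbitrary quotient.
* The printed proof of Thm. 9 first reduces `S₀` to an irreducible `S₁` so that "splits of `Γ` lead to
  pairwise distinct rank-one tensors", and inserts an intermediate merging stage `S₃`; both serve the
  set bookkeeping only and are unnecessary for multisets, so the walk here is `S →` (splits of `Γ`)
  `→` (splits of `B`) `→` (reductions combining the elements with matching `b_{ij}`, `c_{kl}`) `→`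
  standard algorithm, each step an edge of the flip graph read backwards or forwards.
* `RedBase` carries KM's data `(t, I, αᵢ, βᵢ)` explicitly (`I ∖ {t}` = the modified elements), so that
  `S'` is literally "`S'` constructed as above"; Def. 2 (1)–(2) for `I` follow from these data. A
  modified element `Aᵢ⊗Bᵢ⊗(Γᵢ + αᵢβᵢΓ₀)` may vanish; such elements are listed separately (`L₀`) and do
  not appear in `S'` (they are not rank-one tensors in the sense of Def. 1), which is the only reading
  under which "`S'` is a matrix multiplication scheme" (proof of Prop. 3) holds in that case.
* Not here: the symmetry group itself and its orbits (see `MatMulLieIsotropy.lean` for the sandwich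
  symmetries), and all experimental statements of KM §4–§5.

## References

* M. Kauers, J. Moosbauer, *Flip Graphs for Matrix Multiplication*, ISSAC 2023, 381–388,
  doi:10.1145/3597066.3597120, arXiv:2212.01175: §2 Def. 1–2, Prop. 3; §3 Def. 4, Def. 8, the
  paragraph on splits, Thm. 9 with its proof. [KauersMoosbauer2022FlipGraphs]
* M. Bläser, *Fast Matrix Multiplication*, Theory of Computing Graduate Surveys 5 (2013), §4–§5
  (triads, rank, `⟨k,m,n⟩`, the standard algorithm). [Blaser2013]
* J. Moosbauer, M. Poole, *Flip Graphs with Symmetry and New Matrix Multiplication Schemes*,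
  ISSAC 2025, arXiv:2502.04514, Def. 3 (flips, reductions, plus-transitions). [MoosbauerPoole2025]
-/

namespace Literature.Computability.AlgebraicComplexity

open scoped BigOperators
open Multiset

namespace FlipGraph

/-! ## §0 Triads: additivity, scalars, non-vanishing, slot permutations -/

section Triad

variable {K : Type*} [CommRing K] {ι κ μ : Type*}

/-- `(a + a') ⊗ b ⊗ c = a ⊗ b ⊗ c + a' ⊗ b ⊗ c`. [folklore] -/
private theorem triad_add_left (a a' : ι → K) (b : κ → K) (c : μ → K) :
    triad (a + a') b c = triad a b c + triad a' b c := by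
  funext x y z; simp only [triad_apply, Pi.add_apply]; ring

/-- `a ⊗ (b + b') ⊗ c = a ⊗ b ⊗ c + a ⊗ b' ⊗ c`. [folklore] -/
private theorem triad_add_mid (a : ι → K) (b b' : κ → K) (c : μ → K) :
    triad a (b + b') c = triad a b c + triad a b' c := by
  funext x y z; simp only [triad_apply, Pi.add_apply]; ring

/-- `a ⊗ b ⊗ (c + c') = a ⊗ b ⊗ c + a ⊗ b ⊗ c'`. [folklore] -/
private theorem triad_add_right (a : ι → K) (b : κ → K) (c c' : μ → K) :
    triad a b (c + c') = triad a b c + triad a b c' := by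
  funext x y z; simp only [triad_apply, Pi.add_apply]; ring

/-- Scalars move between the slots: `(α•a) ⊗ (β•b) ⊗ c = a ⊗ b ⊗ ((αβ)•c)`. [folklore] -/
private theorem triad_smul_smul (α β : K) (a : ι → K) (b : κ → K) (c : μ → K) :
    triad (α • a) (β • b) c = triad a b ((α * β) • c) := by
  funext x y z; simp only [triad_apply, Pi.smul_apply, smul_eq_mul]; ring

/-- Scalars move between the slots: `a ⊗ (β•b) ⊗ (γ•c) = ((βγ)•a) ⊗ b ⊗ c`. [folklore] -/
private theorem triad_smul_smul' (β γ : K) (a : ι → K) (b : κ → K) (c : μ → K) :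
    triad a (β • b) (γ • c) = triad ((β * γ) • a) b c := by
  funext x y z; simp only [triad_apply, Pi.smul_apply, smul_eq_mul]; ring

/-- A triad with a vanishing factor vanishes. [folklore] -/
private theorem triad_eq_zero_of (a : ι → K) (b : κ → K) (c : μ → K) (h : a = 0 ∨ b = 0 ∨ c = 0) :
    triad a b c = 0 := by
  rcases h with rfl | rfl | rfl <;> funext x y z <;> simp

/-- Over a domain a triad vanishes iff one of its factors does (KM Def. 1: rank-one tensors are the
NON-ZERO `A ⊗ B ⊗ Γ`). [folklore] -/
private theorem triad_eq_zero_iff [NoZeroDivisors K] (a : ι → K) (b : κ → K) (c : μ → K) :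
    triad a b c = 0 ↔ a = 0 ∨ b = 0 ∨ c = 0 := by
  refine ⟨fun h => ?_, triad_eq_zero_of a b c⟩
  by_contra hne
  push Not at hne
  obtain ⟨ha, hb, hc⟩ := hne
  obtain ⟨x, hx⟩ := Function.ne_iff.mp ha
  obtain ⟨y, hy⟩ := Function.ne_iff.mp hb
  obtain ⟨z, hz⟩ := Function.ne_iff.mp hc
  have h' := congrFun (congrFun (congrFun h x) y) z
  simp only [triad_apply, Pi.zero_apply] at h'
  exact mul_ne_zero (mul_ne_zero hx hy) hz h'

/-- Slot transposition `(1 2)`: `(sw₁₂ T) b a c = T a b c`. [folklore] -/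
def sw₁₂ (T : ι → κ → μ → K) : κ → ι → μ → K := fun b a c => T a b c

/-- Slot transposition `(2 3)`: `(sw₂₃ T) a c b = T a b c`. [folklore] -/
def sw₂₃ (T : ι → κ → μ → K) : ι → μ → κ → K := fun a c b => T a b c

/-- Slot transposition `(1 3)`: `(sw₁₃ T) c b a = T a b c`. [folklore] -/
def sw₁₃ (T : ι → κ → μ → K) : μ → κ → ι → K := fun c b a => T a b c

/-- Cyclic slot permutation: `(cyc T) b c a = T a b c` (new slots `(2,3,1)`). [folklore] -/
def cyc (T : ι → κ → μ → K) : κ → μ → ι → K := fun b c a => T a b c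

/-- The other cyclic slot permutation: `(cyc₂ T) c a b = T a b c` (new slots `(3,1,2)`). [folklore] -/
def cyc₂ (T : ι → κ → μ → K) : μ → ι → κ → K := fun c a b => T a b c

/-- `sw₁₂ (a⊗b⊗c) = b⊗a⊗c`. [folklore] -/
@[simp] private theorem sw₁₂_triad (a : ι → K) (b : κ → K) (c : μ → K) :
    sw₁₂ (triad a b c) = triad b a c := by
  funext x y z; simp only [sw₁₂, triad_apply]; ring

/-- `sw₂₃ (a⊗b⊗c) = a⊗c⊗b`. [folklore] -/
@[simp] private theorem sw₂₃_triad (a : ι → K) (b : κ → K) (c : μ → K) :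
    sw₂₃ (triad a b c) = triad a c b := by
  funext x y z; simp only [sw₂₃, triad_apply]; ring

/-- `sw₁₃ (a⊗b⊗c) = c⊗b⊗a`. [folklore] -/
@[simp] private theorem sw₁₃_triad (a : ι → K) (b : κ → K) (c : μ → K) :
    sw₁₃ (triad a b c) = triad c b a := by
  funext x y z; simp only [sw₁₃, triad_apply]; ring

/-- `cyc (a⊗b⊗c) = b⊗c⊗a`. [folklore] -/
@[simp] private theorem cyc_triad (a : ι → K) (b : κ → K) (c : μ → K) :
    cyc (triad a b c) = triad b c a := by
  funext x y z; simp only [cyc, triad_apply]; ring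

/-- `cyc₂ (a⊗b⊗c) = c⊗a⊗b`. [folklore] -/
@[simp] private theorem cyc₂_triad (a : ι → K) (b : κ → K) (c : μ → K) :
    cyc₂ (triad a b c) = triad c a b := by
  funext x y z; simp only [cyc₂, triad_apply]; ring

/-- `sw₁₂ 0 = 0`. [folklore] -/
@[simp] private theorem sw₁₂_zero : sw₁₂ (0 : ι → κ → μ → K) = 0 := rfl
/-- `sw₂₃ 0 = 0`. [folklore] -/
@[simp] private theorem sw₂₃_zero : sw₂₃ (0 : ι → κ → μ → K) = 0 := rfl
/-- `sw₁₃ 0 = 0`. [folklore] -/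
@[simp] private theorem sw₁₃_zero : sw₁₃ (0 : ι → κ → μ → K) = 0 := rfl
/-- `cyc 0 = 0`. [folklore] -/
@[simp] private theorem cyc_zero : cyc (0 : ι → κ → μ → K) = 0 := rfl
/-- `cyc₂ 0 = 0`. [folklore] -/
@[simp] private theorem cyc₂_zero : cyc₂ (0 : ι → κ → μ → K) = 0 := rfl

omit [CommRing K] in
/-- `cyc` is injective. [folklore] -/
private theorem cyc_injective : Function.Injective (cyc : (ι → κ → μ → K) → κ → μ → ι → K) :=
  fun T T' h => by funext a b c; exact congrFun (congrFun (congrFun h b) c) a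

omit [CommRing K] in
/-- `sw₂₃` is injective. [folklore] -/
private theorem sw₂₃_injective : Function.Injective (sw₂₃ : (ι → κ → μ → K) → ι → μ → κ → K) :=
  fun T T' h => by funext a b c; exact congrFun (congrFun (congrFun h a) c) b

end Triad

/-! ## §1 Reductions (KM Prop. 3's construction) and flips (KM Def. 4) on multisets of tensors -/

section Moves

variable {K : Type*} [CommRing K] {ι κ μ : Type*}

/-- The rank-one tensor presented by a factor triple `(A, B, Γ)`. [folklore] -/
abbrev tr (p : (ι → K) × (κ → K) × (μ → K)) : ι → κ → μ → K := triad p.1 p.2.1 p.2.2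

/-- **KM Prop. 3's construction, the case written out** (Def. 2 with `A, B`: the `A`-factors span a
line, the `B`-factors are dependent; the `Γ`-factors are modified), as a relation between multisets
of tensors. Data: the removed element `A₀⊗B₀⊗Γ₀` (KM's index `t`), the other elements of `I` with
their scalars, `L + L₀ = {(Aᵢ, Bᵢ, Γᵢ; αᵢ, βᵢ)}` where `A₀ = αᵢ • Aᵢ` ("`A^{(t)} = α_i A^{(i)}`") and
`B₀ = Σᵢ βᵢ • Bᵢ` ("`B^{(t)} = Σ_{i≠t} β_i B^{(i)}`"), and the rest `R` of `S`; then
`S' = {Aᵢ ⊗ Bᵢ ⊗ (Γᵢ + αᵢβᵢ Γ₀)}_{i ∈ L} + R`, the modified elements listed in `L₀` being exactly those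
that vanish (they are dropped: not rank-one tensors, Def. 1).
[cite: KauersMoosbauer2022FlipGraphs, Prop. 3 (proof) and the definition of "reduction" after it] -/
def RedBase (S S' : Multiset (ι → κ → μ → K)) : Prop :=
  ∃ (a₀ : ι → K) (b₀ : κ → K) (c₀ : μ → K) (R : Multiset (ι → κ → μ → K))
    (L L₀ : Multiset (((ι → K) × (κ → K) × (μ → K)) × (K × K))),
    S = triad a₀ b₀ c₀ ::ₘ ((L + L₀).map (fun q => tr q.1) + R) ∧
    (∀ q ∈ L + L₀, a₀ = q.2.1 • q.1.1) ∧
    b₀ = ((L + L₀).map fun q => q.2.2 • q.1.2.1).sum ∧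
    (∀ q ∈ L₀, triad q.1.1 q.1.2.1 (q.1.2.2 + (q.2.1 * q.2.2) • c₀) = 0) ∧
    S' = L.map (fun q => triad q.1.1 q.1.2.1 (q.1.2.2 + (q.2.1 * q.2.2) • c₀)) + R

/-- **"`S'` is a reduction of `S`"** (KM, after Prop. 3), all six cases of Def. 2 — "`A,B` or `B,A`
or `A,Γ` or `Γ,A` or `B,Γ` or `Γ,B`" (line factor, dependent factor; the third one is modified) —
obtained from the written case `RedBase` by permuting the slots of all tensors.
[cite: KauersMoosbauer2022FlipGraphs, Def. 2 and Prop. 3] -/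
def Reduces (S S' : Multiset (ι → κ → μ → K)) : Prop :=
  RedBase S S' ∨                                  -- `A, B` (modify `Γ`)
  RedBase (S.map sw₂₃) (S'.map sw₂₃) ∨            -- `A, Γ` (modify `B`)
  RedBase (S.map sw₁₂) (S'.map sw₁₂) ∨            -- `B, A` (modify `Γ`)
  RedBase (S.map cyc) (S'.map cyc) ∨              -- `B, Γ` (modify `A`)
  RedBase (S.map cyc₂) (S'.map cyc₂) ∨            -- `Γ, A` (modify `B`)
  RedBase (S.map sw₁₃) (S'.map sw₁₃)              -- `Γ, B` (modify `A`)

/-- **KM Def. 4 (flip), the case written out:** `S` contains `T₁ = A⊗B⊗Γ` and `T₂ = A⊗B'⊗Γ'`, and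
`S' = (S ∖ {T₁, T₂}) ∪ {T₁ + T, T₂ − T}` for `T ∈ {A⊗B⊗Γ', A⊗B'⊗Γ}`.
[cite: KauersMoosbauer2022FlipGraphs, Def. 4] -/
def FlipBase (S S' : Multiset (ι → κ → μ → K)) : Prop :=
  ∃ (a : ι → K) (b b' : κ → K) (c c' : μ → K) (R : Multiset (ι → κ → μ → K)),
    S = triad a b c ::ₘ triad a b' c' ::ₘ R ∧
    (S' = (triad a b c + triad a b c') ::ₘ (triad a b' c' - triad a b c') ::ₘ R ∨
      S' = (triad a b c + triad a b' c) ::ₘ (triad a b' c' - triad a b' c) ::ₘ R)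

/-- **"`S'` is a flip of `S`"** (KM Def. 4, "meant to apply analogously for any permutation of `A`,
`B` and `Γ`"): the shared factor in any of the three slots.
[cite: KauersMoosbauer2022FlipGraphs, Def. 4] -/
def Flips (S S' : Multiset (ι → κ → μ → K)) : Prop :=
  FlipBase S S' ∨ FlipBase (S.map sw₁₂) (S'.map sw₁₂) ∨ FlipBase (S.map sw₁₃) (S'.map sw₁₃)

/-- The reduction keeps the sum (the computation in the proof of KM Prop. 3:
`Σ_{i≠t} Aᵢ⊗Bᵢ⊗αᵢβᵢΓ₀ = A₀ ⊗ (Σ βᵢBᵢ) ⊗ Γ₀ = A₀⊗B₀⊗Γ₀`).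
[cite: KauersMoosbauer2022FlipGraphs, Prop. 3 (proof)] -/
theorem RedBase.sum_eq {S S' : Multiset (ι → κ → μ → K)} (h : RedBase S S') : S'.sum = S.sum := by
  obtain ⟨a₀, b₀, c₀, R, L, L₀, hS, hA, hB, hL₀, hS'⟩ := h
  -- the dropped elements contribute nothing, so we may sum over `L + L₀`
  have hdrop : (L₀.map fun q => triad q.1.1 q.1.2.1 (q.1.2.2 + (q.2.1 * q.2.2) • c₀)).sum = 0 :=
    Multiset.sum_eq_zero fun x hx => by
      obtain ⟨q, hq, rfl⟩ := Multiset.mem_map.mp hx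
      exact hL₀ q hq
  have hsplit : ∀ q ∈ L + L₀, triad q.1.1 q.1.2.1 (q.1.2.2 + (q.2.1 * q.2.2) • c₀) =
      tr q.1 + triad a₀ (q.2.2 • q.1.2.1) c₀ := by
    intro q hq
    rw [triad_add_right, tr, ← triad_smul_smul, ← hA q hq]
  have hkey : ((L + L₀).map fun q => triad q.1.1 q.1.2.1 (q.1.2.2 + (q.2.1 * q.2.2) • c₀)).sum =
      ((L + L₀).map fun q => tr q.1).sum + triad a₀ b₀ c₀ := by
    rw [Multiset.map_congr rfl hsplit, Multiset.sum_map_add]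
    congr 1
    rw [hB]
    -- `Σ A₀ ⊗ (βᵢBᵢ) ⊗ Γ₀ = A₀ ⊗ (Σ βᵢBᵢ) ⊗ Γ₀`
    induction (L + L₀) using Multiset.induction_on with
    | empty => simp [triad_eq_zero_of]
    | cons q M ih => rw [Multiset.map_cons, Multiset.sum_cons, Multiset.map_cons, Multiset.sum_cons,
        triad_add_mid, ih]
  rw [hS', hS, Multiset.sum_add, Multiset.sum_cons, Multiset.sum_add]
  rw [Multiset.map_add, Multiset.sum_add, hdrop, add_zero] at hkey
  rw [hkey]
  abel

/-- A flip keeps the sum: `(T₁ + T) + (T₂ − T) = T₁ + T₂` (KM: a flip "maps a correct scheme to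
another correct scheme"). [cite: KauersMoosbauer2022FlipGraphs, Def. 4] -/
theorem FlipBase.sum_eq {S S' : Multiset (ι → κ → μ → K)} (h : FlipBase S S') :
    S'.sum = S.sum := by
  obtain ⟨a, b, b', c, c', R, hS, hS' | hS'⟩ := h <;>
  · rw [hS, hS', Multiset.sum_cons, Multiset.sum_cons, Multiset.sum_cons, Multiset.sum_cons]
    abel

/-- "Flips always connect vertices belonging to the same level" (KM after Def. 8): a flip keeps the
number of elements. [cite: KauersMoosbauer2022FlipGraphs, Def. 8 (remark following it)] -/
theorem FlipBase.card_eq {S S' : Multiset (ι → κ → μ → K)} (h : FlipBase S S') :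
    card S' = card S := by
  obtain ⟨a, b, b', c, c', R, hS, hS' | hS'⟩ := h <;>
  · rw [hS, hS', Multiset.card_cons, Multiset.card_cons, Multiset.card_cons, Multiset.card_cons]

/-- "A reduction always leads to a vertex belonging to a lower level" (KM after Def. 8): the
construction of Prop. 3 removes the element `t` (and possibly more).
[cite: KauersMoosbauer2022FlipGraphs, Prop. 3 and Def. 8 (remark following it)] -/
theorem RedBase.card_lt {S S' : Multiset (ι → κ → μ → K)} (h : RedBase S S') :
    card S' < card S := by
  obtain ⟨a₀, b₀, c₀, R, L, L₀, hS, -, -, -, hS'⟩ := h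
  rw [hS, hS', Multiset.card_cons, Multiset.card_add, Multiset.card_add, Multiset.card_map,
    Multiset.card_map, Multiset.card_add]
  omega

/-- All six kinds of reduction lower the level. [cite: KauersMoosbauer2022FlipGraphs, Def. 8] -/
theorem Reduces.card_lt {S S' : Multiset (ι → κ → μ → K)} (h : Reduces S S') :
    card S' < card S := by
  rcases h with h | h | h | h | h | h
  · exact h.card_lt
  all_goals simpa only [Multiset.card_map] using h.card_lt

/-- All three kinds of flip keep the level. [cite: KauersMoosbauer2022FlipGraphs, Def. 8] -/
theorem Flips.card_eq {S S' : Multiset (ι → κ → μ → K)} (h : Flips S S') : card S' = card S := by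
  rcases h with h | h | h
  · exact h.card_eq
  all_goals simpa only [Multiset.card_map] using h.card_eq

end Moves

/-! ## §2 Schemes and the flip graph (KM Def. 1 and Def. 8) -/

section Graph

variable {K : Type*} [CommRing K] {ι κ μ : Type*}

/-- **KM Def. 1 (matrix multiplication scheme), multiset reading:** a scheme of the 3-tensor `t` is
a finite multiset of rank-one tensors — "non-zero tensors that can be written as `A ⊗ B ⊗ Γ`" — whose
sum is `t`; for `t = matMulTensor K k m n` an `(n,m,p)`-matrix multiplication scheme. KM's schemes
are the `Scheme`s without repeated elements (module docstring).
[cite: KauersMoosbauer2022FlipGraphs, Def. 1] -/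
structure Scheme (t : ι → κ → μ → K) where
  /-- the elements of the scheme -/
  elts : Multiset (ι → κ → μ → K)
  /-- rank-one tensors are non-zero (Def. 1) -/
  ne_zero : ∀ T ∈ elts, T ≠ 0
  /-- … and of the form `A ⊗ B ⊗ Γ` (Def. 1) -/
  exists_triad : ∀ T ∈ elts, ∃ (a : ι → K) (b : κ → K) (c : μ → K), T = triad a b c
  /-- "whose sum is `M_{n,m,p}`" (Def. 1) -/
  sum_eq : elts.sum = t

variable {t : ι → κ → μ → K}

/-- **KM Def. 1:** "We call `|S|` the rank of the scheme." [cite: KauersMoosbauer2022FlipGraphs, Def. 1] -/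
def Scheme.rank (x : Scheme t) : ℕ := card x.elts

/-- A scheme of rank `r` of `t` witnesses `R(t) ≤ r` (Def. 1: "The rank of a tensor `T` is the
smallest number `r` such that …"). [cite: KauersMoosbauer2022FlipGraphs, Def. 1] -/
theorem Scheme.tensorRank_le (x : Scheme t) : tensorRank t ≤ x.rank := by
  classical
  -- choose a factorisation of every element and index the multiset by a `Fin`-type
  choose! fa fb fc hf using x.exists_triad
  obtain ⟨l, hl⟩ := Quotient.exists_rep x.elts
  have hmem : ∀ i : Fin l.length, l.get i ∈ x.elts := fun i => by
    rw [← hl]; exact Multiset.mem_coe.mpr (List.get_mem l i)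
  have hsum : t = ∑ i : Fin l.length, triad (fa (l.get i)) (fb (l.get i)) (fc (l.get i)) := by
    rw [← x.sum_eq, ← hl, Multiset.quot_mk_to_coe, Multiset.sum_coe, ← Fin.sum_univ_getElem]
    exact Finset.sum_congr rfl fun i _ => hf _ (hmem i)
  have hcard : x.rank = l.length := by
    rw [Scheme.rank, ← hl, Multiset.quot_mk_to_coe, Multiset.coe_card]
  rw [hcard]
  simpa using tensorRank_le_card_of_eq_sum _ _ _ hsum

/-- **KM Def. 8 (1), the edge set `E₁ ∪ E₂`:** `Adj S S'` iff `S'` is a flip of `S` (`E₁`) or a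
reduction of `S` (`E₂`). The vertices here are the schemes themselves; KM's vertices are their orbits
under the symmetry group, on which these edges induce `AdjQuot` below.
[cite: KauersMoosbauer2022FlipGraphs, Def. 8] -/
def Adj (x y : Scheme t) : Prop :=
  Flips x.elts y.elts ∨ Reduces x.elts y.elts

/-- **KM Def. 8 (3):** "the set `{S ∈ V : rank(S) = r}` is called the `r`-th level of `G`."
[cite: KauersMoosbauer2022FlipGraphs, Def. 8] -/
def level (t : ι → κ → μ → K) (r : ℕ) : Set (Scheme t) := {x | x.rank = r}

/-- **KM Def. 8 (2):** the flip graph "of rank at most `r`" is the subgraph induced on the vertices of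
rank at most `r`. [cite: KauersMoosbauer2022FlipGraphs, Def. 8] -/
def AdjLE (r : ℕ) (x y : Scheme t) : Prop := x.rank ≤ r ∧ y.rank ≤ r ∧ Adj x y

/-- "Flips always connect vertices belonging to the same level, whereas a reduction always leads to
a vertex belonging to a lower level" (KM after Def. 8).
[cite: KauersMoosbauer2022FlipGraphs, Def. 8 (remark following it)] -/
theorem Adj.rank_eq_or_lt {x y : Scheme t} (h : Adj x y) :
    (Flips x.elts y.elts ∧ y.rank = x.rank) ∨ (Reduces x.elts y.elts ∧ y.rank < x.rank) := by
  rcases h with h | h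
  · exact Or.inl ⟨h, h.card_eq⟩
  · exact Or.inr ⟨h, h.card_lt⟩

/-- Along an edge the rank does not increase ("We have not introduced any edges leading to higher
levels", KM §3). [cite: KauersMoosbauer2022FlipGraphs, Def. 8 (remark following it)] -/
theorem Adj.rank_le {x y : Scheme t} (h : Adj x y) : y.rank ≤ x.rank := by
  rcases h.rank_eq_or_lt with ⟨-, h⟩ | ⟨-, h⟩
  · exact h.le
  · exact h.le

/-- **KM Def. 8 on orbits:** for an equivalence relation `r` on schemes (KM: "let `V` be the set of
all orbits of `(n,m,p)`-matrix multiplication schemes under the symmetry group"), two classes are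
adjacent iff some representatives are. [cite: KauersMoosbauer2022FlipGraphs, Def. 8] -/
def AdjQuot (r : Setoid (Scheme t)) (p q : Quotient r) : Prop :=
  ∃ x y : Scheme t, Quotient.mk r x = p ∧ Quotient.mk r y = q ∧ Adj x y

/-- Weak connectivity descends to every quotient: if `S` and `S'` are joined in the undirected graph
underlying `(V, E₁ ∪ E₂)` on schemes, so are their classes. [folklore] -/
private theorem eqvGen_adjQuot (r : Setoid (Scheme t)) {x y : Scheme t} (h : Relation.EqvGen Adj x y) :
    Relation.EqvGen (AdjQuot r) (Quotient.mk r x) (Quotient.mk r y) := by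
  induction h with
  | rel a b hab => exact Relation.EqvGen.rel _ _ ⟨a, b, rfl, rfl, hab⟩
  | refl a => exact Relation.EqvGen.refl _
  | symm a b _ ih => exact Relation.EqvGen.symm _ _ ih
  | trans a b c _ _ ih₁ ih₂ => exact Relation.EqvGen.trans _ _ _ ih₁ ih₂

end Graph

/-! ## §3 Two-element reductions and splits (KM §3, the paragraph before Thm. 9) -/

section Split

variable {K : Type*} [CommRing K] {ι κ μ : Type*}

/-- The two-element instance of Prop. 3's construction (written case): `A⊗B⊗Γ` and `A⊗B⊗Γ'`
(`I` = these two, `αᵢ = βᵢ = 1`) are replaced by `A⊗B⊗(Γ + Γ')`.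
[cite: KauersMoosbauer2022FlipGraphs, Prop. 3 (proof)] -/
theorem redBase_merge₃ (a : ι → K) (b : κ → K) (c c' : μ → K) (R : Multiset (ι → κ → μ → K)) :
    RedBase (triad a b c ::ₘ triad a b c' ::ₘ R) (triad a b (c + c') ::ₘ R) := by
  refine ⟨a, b, c', R, {((a, b, c), (1, 1))}, 0, ?_, ?_, ?_, fun q hq => ?_, ?_⟩
  · rw [add_zero, Multiset.map_singleton, Multiset.singleton_add, Multiset.cons_swap]
  · intro q hq
    rw [add_zero, Multiset.mem_singleton] at hq
    subst hq
    exact (one_smul K a).symm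
  · rw [add_zero, Multiset.map_singleton, Multiset.sum_singleton, one_smul]
  · exact absurd hq (Multiset.notMem_zero q)
  · rw [Multiset.map_singleton, Multiset.singleton_add, one_mul, one_smul]

/-- The same two-element instance when `Γ + Γ' = 0`: both elements disappear (the modified element
vanishes and is not an element of the new scheme). [cite: KauersMoosbauer2022FlipGraphs, Prop. 3 (proof)] -/
theorem redBase_cancel₃ (a : ι → K) (b : κ → K) (c c' : μ → K) (R : Multiset (ι → κ → μ → K))
    (h : triad a b (c + c') = 0) :
    RedBase (triad a b c ::ₘ triad a b c' ::ₘ R) R := by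
  refine ⟨a, b, c', R, 0, {((a, b, c), (1, 1))}, ?_, ?_, ?_, fun q hq => ?_, ?_⟩
  · rw [zero_add, Multiset.map_singleton, Multiset.singleton_add, Multiset.cons_swap]
  · intro q hq
    rw [zero_add, Multiset.mem_singleton] at hq
    subst hq
    exact (one_smul K a).symm
  · rw [zero_add, Multiset.map_singleton, Multiset.sum_singleton, one_smul]
  · rw [Multiset.mem_singleton] at hq
    subst hq
    simpa only [one_mul, one_smul] using h
  · rw [Multiset.map_zero, zero_add]

/-- **Two elements sharing `B` and `Γ` are combined by a reduction** (Def. 2 with `B, Γ`, modify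
`A`): `A⊗B⊗Γ, A'⊗B⊗Γ ↦ (A+A')⊗B⊗Γ` — the step "we then use reductions to combine all elements of
`S₄` with matching `b_{i,j}` and `c_{k,l}`" of the proof of Thm. 9.
[cite: KauersMoosbauer2022FlipGraphs, Prop. 3 and Thm. 9 (proof)] -/
theorem reduces_merge₁ (a a' : ι → K) (b : κ → K) (c : μ → K) (R : Multiset (ι → κ → μ → K)) :
    Reduces (triad a b c ::ₘ triad a' b c ::ₘ R) (triad (a + a') b c ::ₘ R) := by
  refine Or.inr (Or.inr (Or.inr (Or.inl ?_)))
  simpa only [Multiset.map_cons, cyc_triad] using redBase_merge₃ b c a a' (R.map cyc)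

/-- The same combination when `A + A' = 0`: the two elements cancel and both disappear.
[cite: KauersMoosbauer2022FlipGraphs, Prop. 3 and Thm. 9 (proof)] -/
theorem reduces_cancel₁ (a a' : ι → K) (b : κ → K) (c : μ → K) (R : Multiset (ι → κ → μ → K))
    (h : triad (a + a') b c = 0) :
    Reduces (triad a b c ::ₘ triad a' b c ::ₘ R) R := by
  refine Or.inr (Or.inr (Or.inr (Or.inl ?_)))
  have h' : triad b c (a + a') = 0 := by rw [← cyc_triad, h, cyc_zero]
  simpa only [Multiset.map_cons, cyc_triad] using redBase_cancel₃ b c a a' (R.map cyc) h'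

/-- **KM's split of `Γ`:** "given a scheme `S` containing a rank-one tensor `A⊗B⊗Γ`, we can replace
this tensor by the two tensors `A⊗B⊗(Γ−Γ')` and `A⊗B⊗Γ'`, for arbitrary `Γ'` … The result is a
scheme that admits a reduction to `S`." [cite: KauersMoosbauer2022FlipGraphs, §3 (splits, before Thm. 9)] -/
theorem reduces_of_split₃ (a : ι → K) (b : κ → K) (c c' : μ → K) (R : Multiset (ι → κ → μ → K)) :
    Reduces (triad a b (c - c') ::ₘ triad a b c' ::ₘ R) (triad a b c ::ₘ R) := by
  have h := redBase_merge₃ a b (c - c') c' R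
  rw [sub_add_cancel] at h
  exact Or.inl h

/-- **KM's split of `B`** ("we can repeatedly split `B` for every element", proof of Thm. 9): the
scheme with `A⊗(B−B')⊗Γ`, `A⊗B'⊗Γ` in place of `A⊗B⊗Γ` admits a reduction to `S` (Def. 2 with
`A, Γ`, modify `B`). [cite: KauersMoosbauer2022FlipGraphs, §3 (splits) and Thm. 9 (proof)] -/
theorem reduces_of_split₂ (a : ι → K) (b b' : κ → K) (c : μ → K) (R : Multiset (ι → κ → μ → K)) :
    Reduces (triad a (b - b') c ::ₘ triad a b' c ::ₘ R) (triad a b c ::ₘ R) := by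
  refine Or.inr (Or.inl ?_)
  simpa only [Multiset.map_cons, sw₂₃_triad, sub_add_cancel] using
    redBase_merge₃ a c (b - b') b' (R.map sw₂₃)

/-- **KM's split of `A`** (for completeness): `(A−A')⊗B⊗Γ`, `A'⊗B⊗Γ` in place of `A⊗B⊗Γ` admits a
reduction to `S` (Def. 2 with `B, Γ`, modify `A`). [cite: KauersMoosbauer2022FlipGraphs, §3 (splits)] -/
theorem reduces_of_split₁ (a a' : ι → K) (b : κ → K) (c : μ → K) (R : Multiset (ι → κ → μ → K)) :
    Reduces (triad (a - a') b c ::ₘ triad a' b c ::ₘ R) (triad a b c ::ₘ R) := by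
  simpa only [sub_add_cancel] using reduces_merge₁ (a - a') a' b c R

/-- A split keeps the sum (it is a reduction read backwards). [cite: KauersMoosbauer2022FlipGraphs, §3 (splits)] -/
theorem sum_split₃ (a : ι → K) (b : κ → K) (c c' : μ → K) (R : Multiset (ι → κ → μ → K)) :
    (triad a b (c - c') ::ₘ triad a b c' ::ₘ R).sum = (triad a b c ::ₘ R).sum := by
  rw [Multiset.sum_cons, Multiset.sum_cons, Multiset.sum_cons, ← add_assoc, ← triad_add_right,
    sub_add_cancel]

/-- A split of `B` keeps the sum. [cite: KauersMoosbauer2022FlipGraphs, §3 (splits)] -/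
theorem sum_split₂ (a : ι → K) (b b' : κ → K) (c : μ → K) (R : Multiset (ι → κ → μ → K)) :
    (triad a (b - b') c ::ₘ triad a b' c ::ₘ R).sum = (triad a b c ::ₘ R).sum := by
  rw [Multiset.sum_cons, Multiset.sum_cons, Multiset.sum_cons, ← add_assoc, ← triad_add_mid,
    sub_add_cancel]

end Split

/-! ## §4 Supports, normal forms and the standard algorithm -/

section Std

variable {K : Type*} [Field K] {ι κ μ : Type*}

/-- Evaluating a sum of tensors. [folklore] -/
private theorem multiset_sum_apply (S : Multiset (ι → κ → μ → K)) (x : ι) (y : κ) (z : μ) :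
    S.sum x y z = (S.map fun T => T x y z).sum := by
  induction S using Multiset.induction_on with
  | empty => simp
  | cons T S ih => simp [Multiset.sum_cons, ih]

/-- A vector whose support lies in `{i}` is a multiple of `e_i`. [folklore] -/
private theorem eq_single_of_support {ν : Type*} [DecidableEq ν] (f : ν → K) (i : ν)
    (h : ∀ j, f j ≠ 0 → j = i) : f = f i • Pi.single i (1 : K) := by
  funext j
  by_cases hj : j = i
  · subst hj; simp
  · have : f j = 0 := by
      by_contra hne
      exact hj (h j hne)
    simp [this, Pi.single_eq_of_ne hj]

variable [DecidableEq κ] [DecidableEq μ]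

/-- `(A ⊗ e_y ⊗ e_z)(x, y', z') = A x · [y' = y] · [z' = z]`. [folklore] -/
private theorem triad_single_single_apply (a : ι → K) (y y' : κ) (z z' : μ) (x : ι) :
    triad a (Pi.single y (1 : K)) (Pi.single z 1) x y' z' =
      if y' = y ∧ z' = z then a x else 0 := by
  rw [triad_apply]
  by_cases hy : y' = y
  · subst hy
    by_cases hz : z' = z
    · subst hz; simp
    · simp [hz]
  · simp [hy]

variable [Fintype κ] [Fintype μ]

open Classical in
/-- The `B`-support of a 3-tensor: the indices `y` with `T(·, y, ·) ≠ 0` (for a rank-one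
`A ⊗ B ⊗ Γ`, the support of `B`). [folklore] -/
noncomputable def supp₂ (T : ι → κ → μ → K) : Finset κ :=
  Finset.univ.filter fun y => ∃ x z, T x y z ≠ 0

open Classical in
/-- The `Γ`-support of a 3-tensor: the indices `z` with `T(·, ·, z) ≠ 0`. [folklore] -/
noncomputable def supp₃ (T : ι → κ → μ → K) : Finset μ :=
  Finset.univ.filter fun z => ∃ x y, T x y z ≠ 0

omit [DecidableEq κ] [DecidableEq μ] [Fintype μ] in
/-- Membership in the `B`-support. [folklore] -/
private theorem mem_supp₂ {T : ι → κ → μ → K} {y : κ} : y ∈ supp₂ T ↔ ∃ x z, T x y z ≠ 0 := by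
  classical
  simp [supp₂, Finset.mem_filter]

omit [DecidableEq κ] [DecidableEq μ] [Fintype κ] in
/-- Membership in the `Γ`-support. [folklore] -/
private theorem mem_supp₃ {T : ι → κ → μ → K} {z : μ} : z ∈ supp₃ T ↔ ∃ x y, T x y z ≠ 0 := by
  classical
  simp [supp₃, Finset.mem_filter]

omit [DecidableEq κ] [DecidableEq μ] [Fintype κ] in
/-- The `Γ`-support of `A ⊗ B ⊗ Γ` with `A, B ≠ 0` is the support of `Γ`. [folklore] -/
private theorem mem_supp₃_triad {a : ι → K} {b : κ → K} (c : μ → K) (ha : a ≠ 0) (hb : b ≠ 0) {z : μ} :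
    z ∈ supp₃ (triad a b c) ↔ c z ≠ 0 := by
  rw [mem_supp₃]
  constructor
  · rintro ⟨x, y, h⟩
    rw [triad_apply] at h
    exact fun hc => h (by rw [hc, mul_zero])
  · intro hc
    obtain ⟨x, hx⟩ := Function.ne_iff.mp ha
    obtain ⟨y, hy⟩ := Function.ne_iff.mp hb
    exact ⟨x, y, by rw [triad_apply]; exact mul_ne_zero (mul_ne_zero hx hy) hc⟩

omit [DecidableEq κ] [DecidableEq μ] [Fintype μ] in
/-- The `B`-support of `A ⊗ B ⊗ Γ` with `A, Γ ≠ 0` is the support of `B`. [folklore] -/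
private theorem mem_supp₂_triad {a : ι → K} (b : κ → K) {c : μ → K} (ha : a ≠ 0) (hc : c ≠ 0) {y : κ} :
    y ∈ supp₂ (triad a b c) ↔ b y ≠ 0 := by
  rw [mem_supp₂]
  constructor
  · rintro ⟨x, z, h⟩
    rw [triad_apply] at h
    exact fun hb => h (by rw [hb, mul_zero, zero_mul])
  · intro hb
    obtain ⟨x, hx⟩ := Function.ne_iff.mp ha
    obtain ⟨z, hz⟩ := Function.ne_iff.mp hc
    exact ⟨x, z, by rw [triad_apply]; exact mul_ne_zero (mul_ne_zero hx hb) hz⟩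

/-- **Normal form.** A rank-one tensor whose `B`- and `Γ`-supports have at most one element is
`A ⊗ e_y ⊗ e_z` with `A ≠ 0` — the shape "`A ⊗ b_{i,j} ⊗ c_{k,l}`" of the elements of `S₄` in the
proof of KM Thm. 9. [cite: KauersMoosbauer2022FlipGraphs, Thm. 9 (proof)] -/
theorem exists_eq_triad_single {T : ι → κ → μ → K} (h0 : T ≠ 0)
    (hT : ∃ (a : ι → K) (b : κ → K) (c : μ → K), T = triad a b c)
    (h2 : (supp₂ T).card ≤ 1) (h3 : (supp₃ T).card ≤ 1) :
    ∃ (y : κ) (z : μ) (a : ι → K), a ≠ 0 ∧ T = triad a (Pi.single y 1) (Pi.single z 1) ∧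
      supp₂ T = {y} ∧ supp₃ T = {z} := by
  obtain ⟨a, b, c, rfl⟩ := hT
  have hne : a ≠ 0 ∧ b ≠ 0 ∧ c ≠ 0 := by
    by_contra h
    exact h0 (triad_eq_zero_of a b c (by tauto))
  obtain ⟨ha, hb, hc⟩ := hne
  obtain ⟨y₀, hy₀⟩ := Function.ne_iff.mp hb
  obtain ⟨z₀, hz₀⟩ := Function.ne_iff.mp hc
  have hy₀' : y₀ ∈ supp₂ (triad a b c) := (mem_supp₂_triad b ha hc).mpr hy₀
  have hz₀' : z₀ ∈ supp₃ (triad a b c) := (mem_supp₃_triad c ha hb).mpr hz₀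
  have h2' : supp₂ (triad a b c) = {y₀} :=
    Finset.eq_singleton_iff_unique_mem.mpr ⟨hy₀', fun y hy => Finset.card_le_one.mp h2 y hy y₀ hy₀'⟩
  have h3' : supp₃ (triad a b c) = {z₀} :=
    Finset.eq_singleton_iff_unique_mem.mpr ⟨hz₀', fun z hz => Finset.card_le_one.mp h3 z hz z₀ hz₀'⟩
  have hb' : b = b y₀ • Pi.single y₀ (1 : K) := eq_single_of_support b y₀ fun y hy => by
    have := (mem_supp₂_triad b ha hc).mpr hy
    rw [h2', Finset.mem_singleton] at this
    exact this
  have hc' : c = c z₀ • Pi.single z₀ (1 : K) := eq_single_of_support c z₀ fun z hz => by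
    have := (mem_supp₃_triad c ha hb).mpr hz
    rw [h3', Finset.mem_singleton] at this
    exact this
  refine ⟨y₀, z₀, (b y₀ * c z₀) • a, smul_ne_zero (mul_ne_zero hy₀ hz₀) ha, ?_, h2', h3'⟩
  conv_lhs => rw [hb', hc']
  rw [triad_smul_smul']

open Classical in
/-- The elements of the **standard scheme** of `t`: `t(·, y, z) ⊗ e_y ⊗ e_z` for the pairs `(y, z)`
with `t(·, y, z) ≠ 0`. For `t = ⟨k,m,n⟩` these are the `k·m·n` products `e_{κν} ⊗ e_{κμ} ⊗ e_{μν}` of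
the standard algorithm (`stdElts_matMulTensor`). [cite: KauersMoosbauer2022FlipGraphs, §2 (standard algorithm) and Thm. 9 (proof, `S₅`)] -/
noncomputable def stdElts (t : ι → κ → μ → K) : Multiset (ι → κ → μ → K) :=
  ((Finset.univ : Finset (κ × μ)).filter fun p => (fun x => t x p.1 p.2) ≠ 0).val.map
    fun p => triad (fun x => t x p.1 p.2) (Pi.single p.1 1) (Pi.single p.2 1)

/-- Membership in `stdElts`. [folklore] -/
private theorem mem_stdElts {t T : ι → κ → μ → K} :
    T ∈ stdElts t ↔ ∃ (y : κ) (z : μ), (fun x => t x y z) ≠ 0 ∧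
      T = triad (fun x => t x y z) (Pi.single y 1) (Pi.single z 1) := by
  classical
  rw [stdElts, Multiset.mem_map]
  constructor
  · rintro ⟨⟨y, z⟩, hp, rfl⟩
    rw [Finset.mem_val, Finset.mem_filter] at hp
    exact ⟨y, z, hp.2, rfl⟩
  · rintro ⟨y, z, h, rfl⟩
    exact ⟨(y, z), by rw [Finset.mem_val, Finset.mem_filter]; exact ⟨Finset.mem_univ _, h⟩, rfl⟩

/-- `stdElts t` has no repeated elements. [folklore] -/
private theorem nodup_stdElts (t : ι → κ → μ → K) : (stdElts t).Nodup := by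
  classical
  refine Multiset.Nodup.map_on (fun p hp q hq hpq => ?_) (Finset.nodup _)
  rw [Finset.mem_val, Finset.mem_filter] at hp
  obtain ⟨x, hx⟩ := Function.ne_iff.mp hp.2
  have h := congrFun (congrFun (congrFun hpq x) p.1) p.2
  rw [triad_single_single_apply, triad_single_single_apply, if_pos ⟨rfl, rfl⟩] at h
  by_cases hc : p.1 = q.1 ∧ p.2 = q.2
  · exact Prod.ext hc.1 hc.2
  · rw [if_neg hc] at h
    exact absurd h hx

/-- The standard scheme sums to `t`: `Σ_{y,z} t(·,y,z) ⊗ e_y ⊗ e_z = t`. [folklore] -/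
private theorem sum_stdElts (t : ι → κ → μ → K) : (stdElts t).sum = t := by
  classical
  have h1 : (stdElts t).sum = ∑ p ∈ (Finset.univ : Finset (κ × μ)).filter
      (fun p => (fun x => t x p.1 p.2) ≠ 0),
      triad (fun x => t x p.1 p.2) (Pi.single p.1 (1 : K)) (Pi.single p.2 1) := rfl
  rw [h1, Finset.sum_filter_of_ne]
  · funext x y z
    rw [Finset.sum_apply, Finset.sum_apply, Finset.sum_apply,
      Finset.sum_eq_single_of_mem (y, z) (Finset.mem_univ _)]
    · rw [triad_single_single_apply, if_pos ⟨rfl, rfl⟩]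
    · rintro ⟨y', z'⟩ - hne
      rw [triad_single_single_apply, if_neg]
      rintro ⟨rfl, rfl⟩
      exact hne rfl
  · intro p _ hp h0
    exact hp (by rw [h0]; exact triad_eq_zero_of _ _ _ (Or.inl rfl))

/-- **The standard scheme** of `t` as a vertex of the flip graph; for `t = ⟨k,m,n⟩` the standard
algorithm (KM §2: "`M_{n,m,p} = Σ a_{ij} ⊗ b_{jk} ⊗ c_{ki}`", the scheme `S₅` at which the proof of
Thm. 9 arrives). [cite: KauersMoosbauer2022FlipGraphs, Def. 1 and Thm. 9 (proof)] -/
noncomputable def stdScheme (t : ι → κ → μ → K) : Scheme t where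
  elts := stdElts t
  ne_zero T hT := by
    obtain ⟨y, z, h, rfl⟩ := mem_stdElts.mp hT
    rw [Ne, triad_eq_zero_iff]
    push Not
    exact ⟨h, by simp, by simp⟩
  exists_triad T hT := by
    obtain ⟨y, z, -, rfl⟩ := mem_stdElts.mp hT
    exact ⟨_, _, _, rfl⟩
  sum_eq := sum_stdElts t

/-- For `⟨k,m,n⟩` the standard scheme consists of the `k·m·n` products `e_{κν} ⊗ e_{κμ} ⊗ e_{μν}`
of the standard algorithm (one for each `(κ, μ, ν)`), as in `tensorRank_matMulTensor_le`.
[cite: Blaser2013, §5] -/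
theorem stdElts_matMulTensor (k m n : ℕ) :
    stdElts (matMulTensor K k m n) = (Finset.univ : Finset (Fin k × Fin m × Fin n)).val.map
      fun p => triad (Pi.single (p.1, p.2.2) (1 : K)) (Pi.single (p.1, p.2.1) 1)
        (Pi.single (p.2.1, p.2.2) 1) := by
  classical
  -- the slices of `⟨k,m,n⟩`: `⟨k,m,n⟩(·, (κ,μ), (μ',ν)) = [μ = μ'] e_{κν}`
  have hslice : ∀ (b : Fin k × Fin m) (c : Fin m × Fin n),
      (fun x => matMulTensor K k m n x b c) =
        if b.2 = c.1 then Pi.single (b.1, c.2) (1 : K) else 0 := by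
    rintro ⟨κ₁, μ₁⟩ ⟨μ₂, ν₂⟩
    funext x
    obtain ⟨x₁, x₂⟩ := x
    by_cases h : μ₁ = μ₂
    · subst h
      by_cases hx : (x₁, x₂) = (κ₁, ν₂)
      · obtain ⟨rfl, rfl⟩ := Prod.mk.inj hx
        simp [matMulTensor]
      · rw [if_pos rfl, Pi.single_eq_of_ne hx]
        simp only [matMulTensor]
        rw [if_neg]
        rintro ⟨h1, -, h3⟩
        exact hx (Prod.ext h1 h3)
    · simp [matMulTensor, h]
  -- reindex the filtered pairs `((κ,μ),(μ,ν))` by the triples `(κ,μ,ν)` (for any decidability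
  -- instance on the filter predicate, in particular the classical one inside `stdElts`)
  have hfilter : ∀ inst : DecidablePred fun p : (Fin k × Fin m) × (Fin m × Fin n) =>
      (fun x => matMulTensor K k m n x p.1 p.2) ≠ 0,
      @Finset.filter _ _ inst (Finset.univ : Finset ((Fin k × Fin m) × (Fin m × Fin n))) =
      (Finset.univ : Finset (Fin k × Fin m × Fin n)).map
        ⟨fun q => ((q.1, q.2.1), (q.2.1, q.2.2)), fun q q' h => by
          simp only [Prod.mk.injEq] at h
          obtain ⟨⟨h1, h2⟩, -, h3⟩ := h
          exact Prod.ext h1 (Prod.ext h2 h3)⟩ := by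
    intro inst
    ext ⟨⟨κ₁, μ₁⟩, ⟨μ₂, ν₂⟩⟩
    rw [Finset.mem_filter, Finset.mem_map, hslice]
    simp only [Finset.mem_univ, true_and, Function.Embedding.coeFn_mk, Prod.mk.injEq]
    constructor
    · intro h
      have hμ : μ₁ = μ₂ := by
        by_contra hμ
        exact h (if_neg hμ)
      subst hμ
      exact ⟨(κ₁, μ₁, ν₂), ⟨rfl, rfl⟩, rfl, rfl⟩
    · rintro ⟨q, ⟨rfl, rfl⟩, h2, rfl⟩
      subst h2
      rw [if_pos rfl]
      intro h0
      have h1 := congrFun h0 (q.1, q.2.2)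
      simp at h1
  rw [stdElts, hfilter, Finset.map_val, Multiset.map_map]
  refine Multiset.map_congr rfl fun q _ => ?_
  simp only [Function.comp_apply, Function.Embedding.coeFn_mk]
  rw [hslice, if_pos rfl]

/-- The standard scheme of `⟨k,m,n⟩` has rank `k·m·n`. [cite: Blaser2013, §5] -/
theorem rank_stdScheme_matMulTensor (k m n : ℕ) :
    (stdScheme (matMulTensor K k m n)).rank = k * m * n := by
  show card (stdElts (matMulTensor K k m n)) = k * m * n
  rw [stdElts_matMulTensor, Multiset.card_map, Finset.card_val, Finset.card_univ,
    Fintype.card_prod, Fintype.card_prod, Fintype.card_fin, Fintype.card_fin, Fintype.card_fin,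
    mul_assoc]

end Std

/-! ## §5 Weak connectivity (KM Thm. 9) -/

section Connectivity

variable {K : Type*} [Field K] {ι κ μ : Type*} [DecidableEq κ] [DecidableEq μ] [Fintype κ] [Fintype μ]
  {t : ι → κ → μ → K}

omit [DecidableEq κ] [DecidableEq μ] [Fintype κ] [Fintype μ] in
/-- Two schemes with the same elements are the same vertex. [folklore] -/
private theorem Scheme.ext' {x y : Scheme t} (h : x.elts = y.elts) : x = y := by
  cases x; cases y; cases h; rfl

/-- The measure driving the splits of `Γ`: total excess of the `Γ`-supports over singletons. [folklore] -/
noncomputable def m₃ (S : Multiset (ι → κ → μ → K)) : ℕ := (S.map fun T => (supp₃ T).card - 1).sum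

/-- The measure driving the splits of `B`. [folklore] -/
noncomputable def m₂ (S : Multiset (ι → κ → μ → K)) : ℕ := (S.map fun T => (supp₂ T).card - 1).sum

omit [DecidableEq κ] [DecidableEq μ] [Fintype κ] in
/-- `m₃` of a `cons`. [folklore] -/
private theorem m₃_cons (T : ι → κ → μ → K) (R : Multiset (ι → κ → μ → K)) :
    m₃ (T ::ₘ R) = ((supp₃ T).card - 1) + m₃ R := by
  simp [m₃, Multiset.map_cons, Multiset.sum_cons]

omit [DecidableEq κ] [DecidableEq μ] [Fintype μ] in
/-- `m₂` of a `cons`. [folklore] -/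
private theorem m₂_cons (T : ι → κ → μ → K) (R : Multiset (ι → κ → μ → K)) :
    m₂ (T ::ₘ R) = ((supp₂ T).card - 1) + m₂ R := by
  simp [m₂, Multiset.map_cons, Multiset.sum_cons]

omit [DecidableEq κ] [DecidableEq μ] [Fintype κ] [Fintype μ] in
/-- The factors of an element of a scheme are non-zero. [folklore] -/
private theorem factors_ne_zero {a : ι → K} {b : κ → K} {c : μ → K} (h : triad a b c ≠ 0) :
    a ≠ 0 ∧ b ≠ 0 ∧ c ≠ 0 := by
  by_contra h'
  exact h (triad_eq_zero_of a b c (by tauto))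

omit [DecidableEq κ] [Fintype κ] in
/-- The `Γ`-support of the piece `A ⊗ B ⊗ (c_{z₀} e_{z₀})` of a split is `{z₀}`. [folklore] -/
private theorem supp₃_piece_single {a : ι → K} {b : κ → K} (c : μ → K) (ha : a ≠ 0) (hb : b ≠ 0)
    {z₀ : μ} (hz₀ : c z₀ ≠ 0) : supp₃ (triad a b (Pi.single z₀ (c z₀))) = {z₀} := by
  ext z
  rw [mem_supp₃_triad _ ha hb, Finset.mem_singleton]
  constructor
  · intro h
    by_contra hne
    exact h (by rw [Pi.single_eq_of_ne hne])
  · rintro rfl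
    rwa [Pi.single_eq_same]

omit [DecidableEq κ] [Fintype κ] in
/-- The `Γ`-support of the other piece `A ⊗ B ⊗ (Γ − c_{z₀} e_{z₀})` is the old one minus `z₀`.
[folklore] -/
private theorem supp₃_piece_sub {a : ι → K} {b : κ → K} (c : μ → K) (ha : a ≠ 0) (hb : b ≠ 0)
    (z₀ : μ) : supp₃ (triad a b (c - Pi.single z₀ (c z₀))) = (supp₃ (triad a b c)).erase z₀ := by
  ext z
  rw [mem_supp₃_triad _ ha hb, Finset.mem_erase, mem_supp₃_triad c ha hb, Pi.sub_apply]
  by_cases hz : z = z₀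
  · subst hz
    simp
  · rw [Pi.single_eq_of_ne hz, sub_zero]
    exact ⟨fun h => ⟨hz, h⟩, fun h => h.2⟩

omit [DecidableEq μ] [Fintype μ] in
/-- The `B`-support of the piece `A ⊗ (b_{y₀} e_{y₀}) ⊗ Γ` of a split of `B` is `{y₀}`. [folklore] -/
private theorem supp₂_piece_single {a : ι → K} (b : κ → K) {c : μ → K} (ha : a ≠ 0) (hc : c ≠ 0)
    {y₀ : κ} (hy₀ : b y₀ ≠ 0) : supp₂ (triad a (Pi.single y₀ (b y₀)) c) = {y₀} := by
  ext y
  rw [mem_supp₂_triad _ ha hc, Finset.mem_singleton]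
  constructor
  · intro h
    by_contra hne
    exact h (by rw [Pi.single_eq_of_ne hne])
  · rintro rfl
    rwa [Pi.single_eq_same]

omit [DecidableEq μ] [Fintype μ] in
/-- The `B`-support of the other piece `A ⊗ (B − b_{y₀} e_{y₀}) ⊗ Γ`. [folklore] -/
private theorem supp₂_piece_sub {a : ι → K} (b : κ → K) {c : μ → K} (ha : a ≠ 0) (hc : c ≠ 0)
    (y₀ : κ) : supp₂ (triad a (b - Pi.single y₀ (b y₀)) c) = (supp₂ (triad a b c)).erase y₀ := by
  ext y
  rw [mem_supp₂_triad _ ha hc, Finset.mem_erase, mem_supp₂_triad b ha hc, Pi.sub_apply]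
  by_cases hy : y = y₀
  · subst hy
    simp
  · rw [Pi.single_eq_of_ne hy, sub_zero]
    exact ⟨fun h => ⟨hy, h⟩, fun h => h.2⟩

omit [DecidableEq κ] [DecidableEq μ] [Fintype κ] in
/-- The `Γ`-support of `A ⊗ B ⊗ Γ` depends only on `Γ` (for non-zero `A, B`). [folklore] -/
private theorem supp₃_triad_congr {a a' : ι → K} {b b' : κ → K} (c : μ → K) (ha : a ≠ 0)
    (hb : b ≠ 0) (ha' : a' ≠ 0) (hb' : b' ≠ 0) : supp₃ (triad a' b' c) = supp₃ (triad a b c) := by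
  ext z
  rw [mem_supp₃_triad c ha' hb', mem_supp₃_triad c ha hb]

omit [Fintype μ] in
/-- The `B`-support of `A ⊗ e_y ⊗ e_z` is `{y}`. [folklore] -/
private theorem supp₂_triad_single {a : ι → K} (ha : a ≠ 0) (y : κ) (z : μ) :
    supp₂ (triad a (Pi.single y (1 : K)) (Pi.single z 1)) = {y} := by
  have h := supp₂_piece_single (Pi.single y (1 : K)) ha (c := Pi.single z (1 : K))
    (Pi.single_ne_zero_iff.mpr one_ne_zero) (y₀ := y) (by simp)
  simpa using h

omit [Fintype κ] in
/-- The `Γ`-support of `A ⊗ e_y ⊗ e_z` is `{z}`. [folklore] -/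
private theorem supp₃_triad_single {a : ι → K} (ha : a ≠ 0) (y : κ) (z : μ) :
    supp₃ (triad a (Pi.single y (1 : K)) (Pi.single z 1)) = {z} := by
  have h := supp₃_piece_single (Pi.single z (1 : K)) ha (b := Pi.single y (1 : K))
    (Pi.single_ne_zero_iff.mpr one_ne_zero) (z₀ := z) (by simp)
  simpa using h

omit [DecidableEq κ] [Fintype κ] in
/-- **Split of `Γ`, one step** (proof of Thm. 9: "we repeatedly split `Γ` for every element"): an
element whose `Γ`-factor involves two basis vectors is split into two, along an edge of the flip
graph (read backwards), and the measure `m₃` drops. [cite: KauersMoosbauer2022FlipGraphs, Thm. 9 (proof)] -/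
theorem split₃_step (S : Scheme t) {T : ι → κ → μ → K} (hT : T ∈ S.elts)
    (hcard : 1 < (supp₃ T).card) :
    ∃ S' : Scheme t, Relation.EqvGen Adj S S' ∧ m₃ S'.elts < m₃ S.elts := by
  obtain ⟨R, hR⟩ := Multiset.exists_cons_of_mem hT
  obtain ⟨a, b, c, rfl⟩ := S.exists_triad T hT
  obtain ⟨ha, hb, hc⟩ := factors_ne_zero (S.ne_zero _ hT)
  obtain ⟨z₀, hz₀, z₁, hz₁, hzz⟩ := Finset.one_lt_card.mp hcard
  have hz₀' := (mem_supp₃_triad c ha hb).mp hz₀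
  have hz₁' := (mem_supp₃_triad c ha hb).mp hz₁
  set c' : μ → K := Pi.single z₀ (c z₀) with hc'
  have hT₂ : triad a b c' ≠ 0 := by
    rw [Ne, triad_eq_zero_iff]
    push Not
    refine ⟨ha, hb, fun h => hz₀' ?_⟩
    simpa [hc'] using congrFun h z₀
  have hT₁ : triad a b (c - c') ≠ 0 := by
    rw [Ne, triad_eq_zero_iff]
    push Not
    refine ⟨ha, hb, fun h => hz₁' ?_⟩
    have h1 := congrFun h z₁
    rwa [Pi.sub_apply, hc', Pi.single_eq_of_ne hzz.symm, sub_zero] at h1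
  have hmemR : ∀ U ∈ R, U ∈ S.elts := fun U hU => by rw [hR]; exact Multiset.mem_cons_of_mem hU
  let S' : Scheme t :=
    { elts := triad a b (c - c') ::ₘ triad a b c' ::ₘ R
      ne_zero := fun U hU => by
        rcases Multiset.mem_cons.mp hU with rfl | hU
        · exact hT₁
        rcases Multiset.mem_cons.mp hU with rfl | hU
        · exact hT₂
        · exact S.ne_zero U (hmemR U hU)
      exists_triad := fun U hU => by
        rcases Multiset.mem_cons.mp hU with rfl | hU
        · exact ⟨_, _, _, rfl⟩
        rcases Multiset.mem_cons.mp hU with rfl | hU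
        · exact ⟨_, _, _, rfl⟩
        · exact S.exists_triad U (hmemR U hU)
      sum_eq := by rw [sum_split₃, ← hR]; exact S.sum_eq }
  refine ⟨S', Relation.EqvGen.symm _ _ (Relation.EqvGen.rel _ _ (Or.inr ?_)), ?_⟩
  · show Reduces (triad a b (c - c') ::ₘ triad a b c' ::ₘ R) S.elts
    rw [hR]
    exact reduces_of_split₃ a b c c' R
  · show m₃ (triad a b (c - c') ::ₘ triad a b c' ::ₘ R) < m₃ S.elts
    rw [hR, m₃_cons, m₃_cons, m₃_cons, hc', supp₃_piece_single c ha hb hz₀',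
      supp₃_piece_sub c ha hb z₀, Finset.card_erase_of_mem hz₀, Finset.card_singleton]
    omega

omit [DecidableEq μ] in
/-- **Split of `B`, one step** ("Then we can repeatedly split `B` for every element"), keeping the
`Γ`-factors basis vectors. [cite: KauersMoosbauer2022FlipGraphs, Thm. 9 (proof)] -/
theorem split₂_step (S : Scheme t) (h3 : ∀ U ∈ S.elts, (supp₃ U).card ≤ 1) {T : ι → κ → μ → K}
    (hT : T ∈ S.elts) (hcard : 1 < (supp₂ T).card) :
    ∃ S' : Scheme t, Relation.EqvGen Adj S S' ∧ m₂ S'.elts < m₂ S.elts ∧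
      ∀ U ∈ S'.elts, (supp₃ U).card ≤ 1 := by
  obtain ⟨R, hR⟩ := Multiset.exists_cons_of_mem hT
  obtain ⟨a, b, c, rfl⟩ := S.exists_triad T hT
  obtain ⟨ha, hb, hc⟩ := factors_ne_zero (S.ne_zero _ hT)
  obtain ⟨y₀, hy₀, y₁, hy₁, hyy⟩ := Finset.one_lt_card.mp hcard
  have hy₀' := (mem_supp₂_triad b ha hc).mp hy₀
  have hy₁' := (mem_supp₂_triad b ha hc).mp hy₁
  set b' : κ → K := Pi.single y₀ (b y₀) with hb'
  have hb'0 : b' ≠ 0 := fun h => hy₀' (by simpa [hb'] using congrFun h y₀)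
  have hbb' : b - b' ≠ 0 := fun h => hy₁' (by
    have h1 := congrFun h y₁
    rwa [Pi.sub_apply, hb', Pi.single_eq_of_ne hyy.symm, sub_zero] at h1)
  have hT₂ : triad a b' c ≠ 0 := by
    rw [Ne, triad_eq_zero_iff]; push Not; exact ⟨ha, hb'0, hc⟩
  have hT₁ : triad a (b - b') c ≠ 0 := by
    rw [Ne, triad_eq_zero_iff]; push Not; exact ⟨ha, hbb', hc⟩
  have hmemR : ∀ U ∈ R, U ∈ S.elts := fun U hU => by rw [hR]; exact Multiset.mem_cons_of_mem hU
  let S' : Scheme t :=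
    { elts := triad a (b - b') c ::ₘ triad a b' c ::ₘ R
      ne_zero := fun U hU => by
        rcases Multiset.mem_cons.mp hU with rfl | hU
        · exact hT₁
        rcases Multiset.mem_cons.mp hU with rfl | hU
        · exact hT₂
        · exact S.ne_zero U (hmemR U hU)
      exists_triad := fun U hU => by
        rcases Multiset.mem_cons.mp hU with rfl | hU
        · exact ⟨_, _, _, rfl⟩
        rcases Multiset.mem_cons.mp hU with rfl | hU
        · exact ⟨_, _, _, rfl⟩
        · exact S.exists_triad U (hmemR U hU)
      sum_eq := by rw [sum_split₂, ← hR]; exact S.sum_eq }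
  refine ⟨S', Relation.EqvGen.symm _ _ (Relation.EqvGen.rel _ _ (Or.inr ?_)), ?_, ?_⟩
  · show Reduces (triad a (b - b') c ::ₘ triad a b' c ::ₘ R) S.elts
    rw [hR]
    exact reduces_of_split₂ a b b' c R
  · show m₂ (triad a (b - b') c ::ₘ triad a b' c ::ₘ R) < m₂ S.elts
    rw [hR, m₂_cons, m₂_cons, m₂_cons, hb', supp₂_piece_single b ha hc hy₀',
      supp₂_piece_sub b ha hc y₀, Finset.card_erase_of_mem hy₀, Finset.card_singleton]
    omega
  · intro U hU
    have hTc : (supp₃ (triad a b c)).card ≤ 1 := h3 _ hT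
    rcases Multiset.mem_cons.mp hU with rfl | hU
    · rwa [supp₃_triad_congr c ha hb ha hbb']
    rcases Multiset.mem_cons.mp hU with rfl | hU
    · rwa [supp₃_triad_congr c ha hb ha hb'0]
    · exact h3 U (hmemR U hU)

/-- **Combining two elements with matching `b_{i,j}` and `c_{k,l}`, one step** ("We then use
reductions to combine all elements of `S₄` with matching `b_{i,j}` and `c_{k,l}`"): along an edge
of the flip graph the number of elements drops (by one, or by two if the elements cancel).
[cite: KauersMoosbauer2022FlipGraphs, Thm. 9 (proof)] -/
theorem merge_step (S : Scheme t) (h2 : ∀ U ∈ S.elts, (supp₂ U).card ≤ 1)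
    (h3 : ∀ U ∈ S.elts, (supp₃ U).card ≤ 1) {T T' : ι → κ → μ → K}
    {R : Multiset (ι → κ → μ → K)} (hR : S.elts = T ::ₘ T' ::ₘ R) (hs₂ : supp₂ T = supp₂ T')
    (hs₃ : supp₃ T = supp₃ T') :
    ∃ S' : Scheme t, Relation.EqvGen Adj S S' ∧ card S'.elts < card S.elts ∧
      (∀ U ∈ S'.elts, (supp₂ U).card ≤ 1) ∧ (∀ U ∈ S'.elts, (supp₃ U).card ≤ 1) := by
  have hT : T ∈ S.elts := by rw [hR]; exact Multiset.mem_cons_self _ _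
  have hT' : T' ∈ S.elts := by rw [hR]; exact Multiset.mem_cons_of_mem (Multiset.mem_cons_self _ _)
  have hmemR : ∀ U ∈ R, U ∈ S.elts := fun U hU => by
    rw [hR]; exact Multiset.mem_cons_of_mem (Multiset.mem_cons_of_mem hU)
  obtain ⟨y, z, a, ha, rfl, hy, hz⟩ :=
    exists_eq_triad_single (S.ne_zero T hT) (S.exists_triad T hT) (h2 T hT) (h3 T hT)
  obtain ⟨y', z', a', ha', rfl, hy', hz'⟩ :=
    exists_eq_triad_single (S.ne_zero T' hT') (S.exists_triad T' hT') (h2 T' hT') (h3 T' hT')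
  obtain rfl : y = y' := Finset.singleton_injective (hy.symm.trans (hs₂.trans hy'))
  obtain rfl : z = z' := Finset.singleton_injective (hz.symm.trans (hs₃.trans hz'))
  have hsum : (triad a (Pi.single y (1 : K)) (Pi.single z 1) ::ₘ
      triad a' (Pi.single y (1 : K)) (Pi.single z 1) ::ₘ R).sum =
      triad (a + a') (Pi.single y 1) (Pi.single z 1) + R.sum := by
    rw [Multiset.sum_cons, Multiset.sum_cons, ← add_assoc, ← triad_add_left]
  by_cases h0 : triad (a + a') (Pi.single y (1 : K)) (Pi.single z 1) = 0
  · -- the two elements cancel: both disappear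
    let S' : Scheme t :=
      { elts := R
        ne_zero := fun U hU => S.ne_zero U (hmemR U hU)
        exists_triad := fun U hU => S.exists_triad U (hmemR U hU)
        sum_eq := by rw [← S.sum_eq, hR, hsum, h0, zero_add] }
    refine ⟨S', Relation.EqvGen.rel _ _ (Or.inr ?_), ?_, fun U hU => h2 U (hmemR U hU),
      fun U hU => h3 U (hmemR U hU)⟩
    · show Reduces S.elts R
      rw [hR]
      exact reduces_cancel₁ a a' _ _ R h0
    · show card R < card S.elts
      rw [hR, Multiset.card_cons, Multiset.card_cons]
      omega
  · -- the two elements are combined into one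
    have haa : a + a' ≠ 0 := fun h => h0 (triad_eq_zero_of _ _ _ (Or.inl h))
    let S' : Scheme t :=
      { elts := triad (a + a') (Pi.single y 1) (Pi.single z 1) ::ₘ R
        ne_zero := fun U hU => by
          rcases Multiset.mem_cons.mp hU with rfl | hU
          · exact h0
          · exact S.ne_zero U (hmemR U hU)
        exists_triad := fun U hU => by
          rcases Multiset.mem_cons.mp hU with rfl | hU
          · exact ⟨_, _, _, rfl⟩
          · exact S.exists_triad U (hmemR U hU)
        sum_eq := by rw [← S.sum_eq, hR, hsum, Multiset.sum_cons] }
    refine ⟨S', Relation.EqvGen.rel _ _ (Or.inr ?_), ?_, fun U hU => ?_, fun U hU => ?_⟩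
    · show Reduces S.elts (triad (a + a') (Pi.single y 1) (Pi.single z 1) ::ₘ R)
      rw [hR]
      exact reduces_merge₁ a a' _ _ R
    · show card (triad (a + a') (Pi.single y 1) (Pi.single z 1) ::ₘ R) < card S.elts
      rw [hR, Multiset.card_cons, Multiset.card_cons, Multiset.card_cons]
      omega
    · rcases Multiset.mem_cons.mp hU with rfl | hU
      · rw [supp₂_triad_single haa, Finset.card_singleton]
      · exact h2 U (hmemR U hU)
    · rcases Multiset.mem_cons.mp hU with rfl | hU
      · rw [supp₃_triad_single haa, Finset.card_singleton]
      · exact h3 U (hmemR U hU)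

omit [DecidableEq κ] [DecidableEq μ] in
/-- In a scheme that is not yet "separated" there are two elements with matching `B`- and
`Γ`-supports (possibly two copies of the same tensor). [folklore] -/
private theorem exists_pair_of_not_separated (S : Multiset (ι → κ → μ → K))
    (h : ¬ (S.Nodup ∧ ∀ T ∈ S, ∀ T' ∈ S, supp₂ T = supp₂ T' → supp₃ T = supp₃ T' → T = T')) :
    ∃ (T T' : ι → κ → μ → K) (R : Multiset (ι → κ → μ → K)),
      S = T ::ₘ T' ::ₘ R ∧ supp₂ T = supp₂ T' ∧ supp₃ T = supp₃ T' := by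
  by_cases hnd : S.Nodup
  · have hsep : ¬ ∀ T ∈ S, ∀ T' ∈ S, supp₂ T = supp₂ T' → supp₃ T = supp₃ T' → T = T' :=
      fun h' => h ⟨hnd, h'⟩
    push Not at hsep
    obtain ⟨T, hT, T', hT', h₂, h₃, hne⟩ := hsep
    obtain ⟨R₁, hR₁⟩ := Multiset.exists_cons_of_mem hT
    have hT'R : T' ∈ R₁ := by
      have h' : T' ∈ T ::ₘ R₁ := hR₁ ▸ hT'
      rcases Multiset.mem_cons.mp h' with h' | h'
      · exact absurd h'.symm hne
      · exact h'
    obtain ⟨R, hR⟩ := Multiset.exists_cons_of_mem hT'R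
    exact ⟨T, T', R, by rw [hR₁, hR], h₂, h₃⟩
  · rw [Multiset.nodup_iff_ne_cons_cons] at hnd
    push Not at hnd
    obtain ⟨T, R, hR⟩ := hnd
    exact ⟨T, T, R, hR, rfl, rfl⟩

omit [DecidableEq κ] [Fintype κ] in
/-- Stage "split `Γ`": every scheme is joined to one all of whose `Γ`-factors are multiples of basis
vectors `c_{i,j}` (KM's `S₂`). [cite: KauersMoosbauer2022FlipGraphs, Thm. 9 (proof)] -/
theorem exists_eqvGen_supp₃ : ∀ (n : ℕ) (S : Scheme t), m₃ S.elts = n →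
    ∃ S' : Scheme t, Relation.EqvGen Adj S S' ∧ ∀ T ∈ S'.elts, (supp₃ T).card ≤ 1 := by
  intro n
  induction n using Nat.strong_induction_on with
  | _ n ih =>
    intro S hn
    by_cases hall : ∀ T ∈ S.elts, (supp₃ T).card ≤ 1
    · exact ⟨S, Relation.EqvGen.refl _, hall⟩
    · push Not at hall
      obtain ⟨T, hT, hlt⟩ := hall
      obtain ⟨S', hSS', hm⟩ := split₃_step S hT hlt
      obtain ⟨S'', h', hgood⟩ := ih (m₃ S'.elts) (hn ▸ hm) S' rfl
      exact ⟨S'', Relation.EqvGen.trans _ _ _ hSS' h', hgood⟩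

omit [DecidableEq μ] in
/-- Stage "split `B`": … then to one all of whose `B`- and `Γ`-factors are multiples of basis vectors
(KM's `S₄`, "every element has the form `A ⊗ b_{i,j} ⊗ c_{k,l}`").
[cite: KauersMoosbauer2022FlipGraphs, Thm. 9 (proof)] -/
theorem exists_eqvGen_supp₂ : ∀ (n : ℕ) (S : Scheme t), (∀ T ∈ S.elts, (supp₃ T).card ≤ 1) →
    m₂ S.elts = n → ∃ S' : Scheme t, Relation.EqvGen Adj S S' ∧
      (∀ T ∈ S'.elts, (supp₂ T).card ≤ 1) ∧ ∀ T ∈ S'.elts, (supp₃ T).card ≤ 1 := by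
  intro n
  induction n using Nat.strong_induction_on with
  | _ n ih =>
    intro S h3 hn
    by_cases hall : ∀ T ∈ S.elts, (supp₂ T).card ≤ 1
    · exact ⟨S, Relation.EqvGen.refl _, hall, h3⟩
    · push Not at hall
      obtain ⟨T, hT, hlt⟩ := hall
      obtain ⟨S', hSS', hm, h3'⟩ := split₂_step S h3 hT hlt
      obtain ⟨S'', h', hgood, h3''⟩ := ih (m₂ S'.elts) (hn ▸ hm) S' h3' rfl
      exact ⟨S'', Relation.EqvGen.trans _ _ _ hSS' h', hgood, h3''⟩

/-- Stage "combine": … then to one which "for all `i,j,k,l` contains at most one element of the form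
`A ⊗ b_{i,j} ⊗ c_{k,l}`" (KM's `S₅`). [cite: KauersMoosbauer2022FlipGraphs, Thm. 9 (proof)] -/
theorem exists_eqvGen_separated : ∀ (n : ℕ) (S : Scheme t), (∀ T ∈ S.elts, (supp₂ T).card ≤ 1) →
    (∀ T ∈ S.elts, (supp₃ T).card ≤ 1) → card S.elts = n →
    ∃ S' : Scheme t, Relation.EqvGen Adj S S' ∧ (∀ T ∈ S'.elts, (supp₂ T).card ≤ 1) ∧
      (∀ T ∈ S'.elts, (supp₃ T).card ≤ 1) ∧ S'.elts.Nodup ∧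
      ∀ T ∈ S'.elts, ∀ T' ∈ S'.elts, supp₂ T = supp₂ T' → supp₃ T = supp₃ T' → T = T' := by
  intro n
  induction n using Nat.strong_induction_on with
  | _ n ih =>
    intro S h2 h3 hn
    by_cases hgood : S.elts.Nodup ∧
        ∀ T ∈ S.elts, ∀ T' ∈ S.elts, supp₂ T = supp₂ T' → supp₃ T = supp₃ T' → T = T'
    · exact ⟨S, Relation.EqvGen.refl _, h2, h3, hgood.1, hgood.2⟩
    · obtain ⟨T, T', R, hR, hs₂, hs₃⟩ := exists_pair_of_not_separated S.elts hgood
      obtain ⟨S', hSS', hlt, h2', h3'⟩ := merge_step S h2 h3 hR hs₂ hs₃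
      obtain ⟨S'', h', hgood⟩ := ih (card S'.elts) (hn ▸ hlt) S' h2' h3' rfl
      exact ⟨S'', Relation.EqvGen.trans _ _ _ hSS' h', hgood⟩

/-- In a separated scheme in normal form, the element with supports `{y}`, `{z}` is
`t(·,y,z) ⊗ e_y ⊗ e_z`: its `A`-factor is read off from the sum ("Therefore, `S₅` must be the
standard algorithm"). [cite: KauersMoosbauer2022FlipGraphs, Thm. 9 (proof)] -/
theorem eq_triad_slice_of_separated (S : Scheme t) (h2 : ∀ T ∈ S.elts, (supp₂ T).card ≤ 1)
    (h3 : ∀ T ∈ S.elts, (supp₃ T).card ≤ 1) (hnd : S.elts.Nodup)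
    (hsep : ∀ T ∈ S.elts, ∀ T' ∈ S.elts, supp₂ T = supp₂ T' → supp₃ T = supp₃ T' → T = T')
    {T : ι → κ → μ → K} (hT : T ∈ S.elts) {y : κ} {z : μ} (hy : supp₂ T = {y})
    (hz : supp₃ T = {z}) :
    T = triad (fun x => t x y z) (Pi.single y 1) (Pi.single z 1) := by
  obtain ⟨y₁, z₁, a, ha, rfl, hy₁, hz₁⟩ :=
    exists_eq_triad_single (S.ne_zero T hT) (S.exists_triad T hT) (h2 T hT) (h3 T hT)
  obtain rfl : y₁ = y := Finset.singleton_injective (hy₁.symm.trans hy)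
  obtain rfl : z₁ = z := Finset.singleton_injective (hz₁.symm.trans hz)
  obtain ⟨R, hR⟩ := Multiset.exists_cons_of_mem hT
  have hTR : triad a (Pi.single y₁ (1 : K)) (Pi.single z₁ 1) ∉ R :=
    (Multiset.nodup_cons.mp (hR ▸ hnd)).1
  -- every other element vanishes at `(·, y, z)`
  have hrest : ∀ x, (R.map fun U => U x y₁ z₁).sum = 0 := by
    intro x
    refine Multiset.sum_eq_zero fun v hv => ?_
    obtain ⟨U, hU, rfl⟩ := Multiset.mem_map.mp hv
    have hUS : U ∈ S.elts := by rw [hR]; exact Multiset.mem_cons_of_mem hU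
    have hne : U ≠ triad a (Pi.single y₁ (1 : K)) (Pi.single z₁ 1) := by
      rintro rfl; exact hTR hU
    obtain ⟨y₂, z₂, a₂, ha₂, rfl, hy₂, hz₂⟩ :=
      exists_eq_triad_single (S.ne_zero U hUS) (S.exists_triad U hUS) (h2 U hUS) (h3 U hUS)
    rw [triad_single_single_apply]
    split_ifs with hyz
    · obtain ⟨rfl, rfl⟩ := hyz
      exact absurd (hsep _ hUS _ hT (hy₂.trans hy₁.symm) (hz₂.trans hz₁.symm)) hne
    · rfl
  have hval : (fun x => t x y₁ z₁) = a := by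
    funext x
    rw [← S.sum_eq, multiset_sum_apply, hR, Multiset.map_cons, Multiset.sum_cons, hrest x,
      add_zero, triad_single_single_apply, if_pos ⟨rfl, rfl⟩]
  rw [hval]

/-- **"Therefore, `S₅` must be the standard algorithm":** a separated scheme in normal form IS the
standard scheme. [cite: KauersMoosbauer2022FlipGraphs, Thm. 9 (proof)] -/
theorem elts_eq_stdElts_of_separated (S : Scheme t) (h2 : ∀ T ∈ S.elts, (supp₂ T).card ≤ 1)
    (h3 : ∀ T ∈ S.elts, (supp₃ T).card ≤ 1) (hnd : S.elts.Nodup)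
    (hsep : ∀ T ∈ S.elts, ∀ T' ∈ S.elts, supp₂ T = supp₂ T' → supp₃ T = supp₃ T' → T = T') :
    S.elts = stdElts t := by
  refine (Multiset.Nodup.ext hnd (nodup_stdElts t)).mpr fun T => ⟨fun hT => ?_, fun hT => ?_⟩
  · obtain ⟨y, z, a, ha, hTeq, hy, hz⟩ :=
      exists_eq_triad_single (S.ne_zero T hT) (S.exists_triad T hT) (h2 T hT) (h3 T hT)
    have h := eq_triad_slice_of_separated S h2 h3 hnd hsep hT hy hz
    refine mem_stdElts.mpr ⟨y, z, fun h0 => S.ne_zero T hT ?_, h⟩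
    rw [h, h0]
    exact triad_eq_zero_of _ _ _ (Or.inl rfl)
  · obtain ⟨y, z, hslice, rfl⟩ := mem_stdElts.mp hT
    -- some element of `S` is non-zero at `(x, y, z)`; it is the sought one
    obtain ⟨x, hx⟩ := Function.ne_iff.mp hslice
    have hx' : (S.elts.map fun U => U x y z).sum ≠ 0 := by
      rw [← multiset_sum_apply, S.sum_eq]; exact hx
    obtain ⟨v, hv, hv0⟩ : ∃ v ∈ S.elts.map (fun U => U x y z), v ≠ 0 := by
      by_contra hall
      push Not at hall
      exact hx' (Multiset.sum_eq_zero hall)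
    obtain ⟨U, hU, rfl⟩ := Multiset.mem_map.mp hv
    obtain ⟨y₂, z₂, a₂, ha₂, hUeq, hy₂, hz₂⟩ :=
      exists_eq_triad_single (S.ne_zero U hU) (S.exists_triad U hU) (h2 U hU) (h3 U hU)
    have hyz : y = y₂ ∧ z = z₂ := by
      rw [hUeq, triad_single_single_apply] at hv0
      by_contra h
      exact hv0 (if_neg h)
    obtain ⟨rfl, rfl⟩ := hyz
    rwa [eq_triad_slice_of_separated S h2 h3 hnd hsep hU hy₂ hz₂] at hU

/-- **Every scheme is joined to the standard scheme** in the undirected graph underlying the flip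
graph — the walk of the proof of KM Thm. 9 (splits of `Γ`, splits of `B`, reductions combining
matching elements), for an arbitrary 3-tensor `t` over a field with finite `B`- and `Γ`-index
types. [cite: KauersMoosbauer2022FlipGraphs, Thm. 9 (proof)] -/
theorem eqvGen_adj_stdScheme (S : Scheme t) : Relation.EqvGen Adj S (stdScheme t) := by
  obtain ⟨S₁, h₁, n₃⟩ := exists_eqvGen_supp₃ _ S rfl
  obtain ⟨S₂, h₂, n₂, n₃'⟩ := exists_eqvGen_supp₂ _ S₁ n₃ rfl
  obtain ⟨S₃, h₃, n₂', n₃'', hnd, hsep⟩ := exists_eqvGen_separated _ S₂ n₂ n₃' rfl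
  have hS₃ : S₃ = stdScheme t := Scheme.ext' (elts_eq_stdElts_of_separated S₃ n₂' n₃'' hnd hsep)
  rw [← hS₃]
  exact Relation.EqvGen.trans _ _ _ h₁ (Relation.EqvGen.trans _ _ _ h₂ h₃)

/-- Hence any two schemes of `t` are joined. [cite: KauersMoosbauer2022FlipGraphs, Thm. 9] -/
theorem eqvGen_adj (S S' : Scheme t) : Relation.EqvGen Adj S S' :=
  Relation.EqvGen.trans _ _ _ (eqvGen_adj_stdScheme S)
    (Relation.EqvGen.symm _ _ (eqvGen_adj_stdScheme S'))

/-- … and so are their classes under any equivalence relation on schemes (Def. 8: KM's vertices are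
orbits under the symmetry group). [cite: KauersMoosbauer2022FlipGraphs, Def. 8 and Thm. 9] -/
theorem eqvGen_adjQuot_all (r : Setoid (Scheme t)) (p q : Quotient r) :
    Relation.EqvGen (AdjQuot r) p q := by
  induction p using Quotient.inductionOn with
  | h x =>
    induction q using Quotient.inductionOn with
    | h y => exact eqvGen_adjQuot r (eqvGen_adj x y)

/-- **KM Thm. 9.** "For every `n,m,p ∈ ℕ`, the `(n,m,p)`-flip graph is weakly connected, i.e., the
undirected graph obtained from it by replacing every reduction by a bidirectional edge, is
connected": any two `(k,m,n)`-matrix multiplication schemes over a field `K` are joined in the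
equivalence closure of `Adj = E₁ ∪ E₂` (flips and reductions).
[cite: KauersMoosbauer2022FlipGraphs, Thm. 9] -/
theorem kauersMoosbauer2023_thm9 (k m n : ℕ) (S S' : Scheme (matMulTensor K k m n)) :
    Relation.EqvGen Adj S S' :=
  eqvGen_adj S S'

/-- **KM Thm. 9 on orbits** (Def. 8: the vertices of the flip graph are the orbits of schemes under
the symmetry group): for every equivalence relation `r` on `(k,m,n)`-schemes — in particular the
orbit relation of any group acting on schemes — the induced graph on the classes is weakly
connected. [cite: KauersMoosbauer2022FlipGraphs, Def. 8 and Thm. 9] -/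
theorem kauersMoosbauer2023_thm9_quot (k m n : ℕ) (r : Setoid (Scheme (matMulTensor K k m n)))
    (p q : Quotient r) : Relation.EqvGen (AdjQuot r) p q :=
  eqvGen_adjQuot_all r p q

/-- "For any given scheme `S₀`, we construct a path to the standard algorithm in the underlying
undirected graph" (proof of Thm. 9): every `(k,m,n)`-scheme is joined to the standard algorithm
(whose rank is `k·m·n`, `rank_stdScheme_matMulTensor`).
[cite: KauersMoosbauer2022FlipGraphs, Thm. 9 (proof)] -/
theorem eqvGen_adj_stdScheme_matMulTensor (k m n : ℕ) (S : Scheme (matMulTensor K k m n)) :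
    Relation.EqvGen Adj S (stdScheme (matMulTensor K k m n)) :=
  eqvGen_adj_stdScheme S

end Connectivity

/-! ## §6 Plus-transitions (Moosbauer–Poole 2025, Def. 3)

Moosbauer–Poole (ISSAC 2025, arXiv:2502.04514, Def. 3) use, besides KM's flips and the two-element
reductions `A⊗B⊗C, A⊗B⊗C' ↦ A⊗B⊗(C+C')` (`redBase_merge₃` above), a third move applicable to ANY two
elements: the *plus-transition*
`S' = S ∖ {A⊗B⊗C, A'⊗B'⊗C'} ∪ {(A−A')⊗B⊗C, A'⊗B⊗(C+C'), A'⊗(B'−B)⊗C'}`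
("These definitions apply for arbitrary permutations of `A, B` and `C`"), and justify it as "an
inverse reduction followed by a flip". Both facts are recorded here on multisets of tensors. -/

section Plus

variable {K : Type*} [CommRing K] {ι κ μ : Type*}

/-- **The plus-transition identity** (MP Def. 3 and the display following it):
`A⊗B⊗C + A'⊗B'⊗C' = (A−A')⊗B⊗C + A'⊗B⊗(C+C') + A'⊗(B'−B)⊗C'`, for ANY two rank-one tensors.
[cite: MoosbauerPoole2025, Def. 3] -/
theorem triad_add_triad_eq_plusTransition (a a' : ι → K) (b b' : κ → K) (c c' : μ → K) :
    triad a b c + triad a' b' c' =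
      triad (a - a') b c + triad a' b (c + c') + triad a' (b' - b) c' := by
  funext x y z
  simp only [triad_apply, Pi.add_apply, Pi.sub_apply]
  ring

/-- A plus-transition keeps the sum of the scheme (MP: "plus-transitions of matrix multiplication
schemes are matrix multiplication schemes again"). [cite: MoosbauerPoole2025, Def. 3] -/
theorem sum_plusTransition (a a' : ι → K) (b b' : κ → K) (c c' : μ → K)
    (R : Multiset (ι → κ → μ → K)) :
    (triad (a - a') b c ::ₘ triad a' b (c + c') ::ₘ triad a' (b' - b) c' ::ₘ R).sum =
      (triad a b c ::ₘ triad a' b' c' ::ₘ R).sum := by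
  simp only [Multiset.sum_cons, ← add_assoc]
  rw [← triad_add_triad_eq_plusTransition a a' b b' c c']

/-- **"We can write them as an inverse reduction followed by a flip"** (MP, after Def. 3): the
intermediate multiset `{(A−A')⊗B⊗C, A'⊗B⊗C, A'⊗B'⊗C'} + R` reduces to `S` (it is the split of `A`
of `A⊗B⊗C`, `reduces_of_split₁`) and flips to the plus-transition `S'` (KM Def. 4 with the shared
factor `A'`, `T = A'⊗B⊗C'`). [cite: MoosbauerPoole2025, Def. 3 (and the display following it)] -/
theorem plusTransition_eq_split_then_flip (a a' : ι → K) (b b' : κ → K) (c c' : μ → K)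
    (R : Multiset (ι → κ → μ → K)) :
    Reduces (triad (a - a') b c ::ₘ triad a' b c ::ₘ triad a' b' c' ::ₘ R)
        (triad a b c ::ₘ triad a' b' c' ::ₘ R) ∧
      Flips (triad (a - a') b c ::ₘ triad a' b c ::ₘ triad a' b' c' ::ₘ R)
        (triad (a - a') b c ::ₘ triad a' b (c + c') ::ₘ triad a' (b' - b) c' ::ₘ R) := by
  refine ⟨reduces_of_split₁ a a' b c (triad a' b' c' ::ₘ R), Or.inl ?_⟩
  refine ⟨a', b, b', c, c', triad (a - a') b c ::ₘ R, ?_, Or.inl ?_⟩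
  · rw [Multiset.cons_swap (triad (a - a') b c) (triad a' b c),
      Multiset.cons_swap (triad (a - a') b c) (triad a' b' c')]
  · have h₁ : triad a' b c + triad a' b c' = triad a' b (c + c') := by
      funext x y z; simp only [triad_apply, Pi.add_apply]; ring
    have h₂ : triad a' b' c' - triad a' b c' = triad a' (b' - b) c' := by
      funext x y z; simp only [triad_apply, Pi.sub_apply]; ring
    rw [h₁, h₂, Multiset.cons_swap (triad (a - a') b c) (triad a' b (c + c')),
      Multiset.cons_swap (triad (a - a') b c) (triad a' (b' - b) c')]

/-- Hence a plus-transition raises the number of elements by one and, on schemes of `t`, stays in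
the weak component: `S` and `S'` are joined by one reduction (backwards) and one flip.
[cite: MoosbauerPoole2025, Def. 3] -/
theorem card_plusTransition (a a' : ι → K) (b b' : κ → K) (c c' : μ → K)
    (R : Multiset (ι → κ → μ → K)) :
    card (triad (a - a') b c ::ₘ triad a' b (c + c') ::ₘ triad a' (b' - b) c' ::ₘ R) =
      card (triad a b c ::ₘ triad a' b' c' ::ₘ R) + 1 := by
  simp only [Multiset.card_cons]

end Plus

/-! ## §7 Every flip and every reduction keeps the sum (all slot cases) -/

section SumAll

variable {K : Type*} [CommRing K] {ι κ μ : Type*}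

/-- A map of tensors that is additive commutes with multiset sums (bookkeeping). [folklore] -/
private theorem sum_map_of_additive {X Y : Type*} [AddCommMonoid X] [AddCommMonoid Y] (f : X → Y)
    (h0 : f 0 = 0) (hadd : ∀ a b, f (a + b) = f a + f b) (S : Multiset X) :
    (S.map f).sum = f S.sum := by
  induction S using Multiset.induction_on with
  | empty => simp [h0]
  | cons T S ih => rw [Multiset.map_cons, Multiset.sum_cons, Multiset.sum_cons, hadd, ih]

omit [CommRing K] in
/-- `sw₁₂` is injective. [folklore] -/
private theorem sw₁₂_injective :
    Function.Injective (sw₁₂ : (ι → κ → μ → K) → κ → ι → μ → K) :=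
  fun T T' h => by funext a b c; exact congrFun (congrFun (congrFun h b) a) c

omit [CommRing K] in
/-- `sw₁₃` is injective. [folklore] -/
private theorem sw₁₃_injective :
    Function.Injective (sw₁₃ : (ι → κ → μ → K) → μ → κ → ι → K) :=
  fun T T' h => by funext a b c; exact congrFun (congrFun (congrFun h c) b) a

omit [CommRing K] in
/-- `cyc₂` is injective. [folklore] -/
private theorem cyc₂_injective :
    Function.Injective (cyc₂ : (ι → κ → μ → K) → μ → ι → κ → K) :=
  fun T T' h => by funext a b c; exact congrFun (congrFun (congrFun h c) a) b

/-- Transport of a sum identity along an injective additive slot permutation (bookkeeping).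
[folklore] -/
private theorem sum_eq_of_map {X Y : Type*} [AddCommMonoid X] [AddCommMonoid Y] (f : X → Y)
    (h0 : f 0 = 0) (hadd : ∀ a b, f (a + b) = f a + f b) (hf : Function.Injective f)
    {S S' : Multiset X} (h : (S'.map f).sum = (S.map f).sum) : S'.sum = S.sum := by
  rw [sum_map_of_additive f h0 hadd, sum_map_of_additive f h0 hadd] at h
  exact hf h

/-- **Every reduction keeps the sum** (KM Prop. 3, "in the other cases the proof works
analogously"): all six cases of `Reduces`. [cite: KauersMoosbauer2022FlipGraphs, Prop. 3] -/
theorem Reduces.sum_eq {S S' : Multiset (ι → κ → μ → K)} (h : Reduces S S') : S'.sum = S.sum := by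
  rcases h with h | h | h | h | h | h
  · exact h.sum_eq
  · exact sum_eq_of_map sw₂₃ rfl (fun _ _ => rfl) sw₂₃_injective h.sum_eq
  · exact sum_eq_of_map sw₁₂ rfl (fun _ _ => rfl) sw₁₂_injective h.sum_eq
  · exact sum_eq_of_map cyc rfl (fun _ _ => rfl) cyc_injective h.sum_eq
  · exact sum_eq_of_map cyc₂ rfl (fun _ _ => rfl) cyc₂_injective h.sum_eq
  · exact sum_eq_of_map sw₁₃ rfl (fun _ _ => rfl) sw₁₃_injective h.sum_eq

/-- **Every flip keeps the sum** (KM Def. 4, "for any permutation of `A`, `B` and `Γ`": a flip "maps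
a correct scheme to another correct scheme"). [cite: KauersMoosbauer2022FlipGraphs, Def. 4] -/
theorem Flips.sum_eq {S S' : Multiset (ι → κ → μ → K)} (h : Flips S S') : S'.sum = S.sum := by
  rcases h with h | h | h
  · exact h.sum_eq
  · exact sum_eq_of_map sw₁₂ rfl (fun _ _ => rfl) sw₁₂_injective h.sum_eq
  · exact sum_eq_of_map sw₁₃ rfl (fun _ _ => rfl) sw₁₃_injective h.sum_eq

/-- Hence along every edge of the flip graph the sum is unchanged: if `S` is a scheme of `t`, every
flip or reduction `S'` of `S` again sums to `t` (it is a scheme of `t` as soon as its elements are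
non-zero rank-one tensors). [cite: KauersMoosbauer2022FlipGraphs, Def. 4 and Prop. 3] -/
theorem sum_eq_of_flips_or_reduces {t : ι → κ → μ → K} (x : Scheme t)
    {S' : Multiset (ι → κ → μ → K)} (h : Flips x.elts S' ∨ Reduces x.elts S') : S'.sum = t := by
  rcases h with h | h
  · rw [h.sum_eq, x.sum_eq]
  · rw [h.sum_eq, x.sum_eq]

end SumAll

/-! ## §8 Reducible vertices have reduction edges (KM Prop. 3 as an edge of the flip graph) -/

section ReducibleEdge

variable {K : Type*} [Field K] {ι κ μ : Type*}

/-- **The core of Prop. 3 as an edge** (case `A, B` of Def. 2): a family of non-zero rank-one tensors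
`(w s ⊗ u s ⊗ v s)_s` with Def. 2 data `I` (the `w i`, `i ∈ I`, span a line; the `u i`, `i ∈ I`, are
dependent) has a reduction in the sense of `RedBase` all of whose elements are non-zero rank-one
tensors — KM's construction with `t ∈ I`, `B^{(t)} = Σ βᵢ B^{(i)}`, `A^{(t)} = αᵢ A^{(i)}`, the
vanishing modified elements dropped. [cite: KauersMoosbauer2022FlipGraphs, Prop. 3 (proof)] -/
theorem exists_redBase_of_caseAB {σ : Type*} [Fintype σ] [DecidableEq σ] (w : σ → ι → K)
    (u : σ → κ → K) (v : σ → μ → K) (h0 : ∀ s, triad (w s) (u s) (v s) ≠ 0) (I : Finset σ)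
    (h1 : Module.finrank K (Submodule.span K (w '' (I : Set σ))) = 1)
    (h2 : ¬ LinearIndepOn K u (I : Set σ)) :
    ∃ S' : Multiset (ι → κ → μ → K),
      RedBase ((Finset.univ : Finset σ).val.map fun s => triad (w s) (u s) (v s)) S' ∧
      (∀ T ∈ S', T ≠ 0) ∧
      (∀ T ∈ S', ∃ (a : ι → K) (b : κ → K) (c : μ → K), T = triad a b c) := by
  classical
  have hw : ∀ s, w s ≠ 0 := fun s h => h0 s (triad_eq_zero_of _ _ _ (Or.inl h))
  -- Def. 2 (2): a non-trivial vanishing combination, `g t₀ ≠ 0`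
  rw [not_linearIndepOn_finset_iff] at h2
  obtain ⟨g, hg0, t₀, ht₀, hgt⟩ := h2
  set β : σ → K := fun s => -(g s * (g t₀)⁻¹) with hβ
  have hsplit : g t₀ • u t₀ + ∑ s ∈ I.erase t₀, g s • u s = 0 := by
    rwa [Finset.add_sum_erase I (fun s => g s • u s) ht₀]
  have hut : u t₀ = ∑ s ∈ I.erase t₀, β s • u s := by
    have h' : u t₀ = -((g t₀)⁻¹ • ∑ s ∈ I.erase t₀, g s • u s) := by
      rw [eq_neg_iff_add_eq_zero, ← inv_smul_smul₀ hgt (u t₀), ← smul_add, hsplit, smul_zero]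
    rw [h', Finset.smul_sum, ← Finset.sum_neg_distrib]
    refine Finset.sum_congr rfl fun s _ => ?_
    rw [hβ, smul_smul, neg_smul, mul_comm]
  -- Def. 2 (1): every `w i`, `i ∈ I`, spans the line of `w t₀`
  have hline : ∀ s ∈ I, ∃ a : K, a • w s = w t₀ := by
    intro s hs
    have hsV : w s ∈ Submodule.span K (w '' (I : Set σ)) :=
      Submodule.subset_span (Set.mem_image_of_mem w (Finset.mem_coe.mpr hs))
    have htV : w t₀ ∈ Submodule.span K (w '' (I : Set σ)) :=
      Submodule.subset_span (Set.mem_image_of_mem w (Finset.mem_coe.mpr ht₀))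
    have hne : (⟨w s, hsV⟩ : Submodule.span K (w '' (I : Set σ))) ≠ 0 := by
      intro h
      exact hw s (by simpa using congrArg Subtype.val h)
    obtain ⟨a, ha⟩ := (finrank_eq_one_iff_of_nonzero' _ hne).mp h1 ⟨w t₀, htV⟩
    exact ⟨a, by simpa using congrArg Subtype.val ha⟩
  choose! α hα using hline
  -- KM's data: the modified elements (kept if non-zero: `L`; dropped if zero: `L₀`), the rest `R`
  let f : σ → (ι → κ → μ → K) := fun s => triad (w s) (u s) (v s)
  let md : σ → (ι → κ → μ → K) := fun s => triad (w s) (u s) (v s + (α s * β s) • v t₀)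
  let qf : σ → ((ι → K) × (κ → K) × (μ → K)) × (K × K) := fun s => ((w s, u s, v s), (α s, β s))
  let J : Finset σ := I.erase t₀
  let L := (J.filter fun s => md s ≠ 0).val.map qf
  let L₀ := (J.filter fun s => ¬ md s ≠ 0).val.map qf
  let R := ((Finset.univ : Finset σ) \ I).val.map f
  have hmdq : ∀ s, triad (qf s).1.1 (qf s).1.2.1 ((qf s).1.2.2 + ((qf s).2.1 * (qf s).2.2) • v t₀) =
      md s := fun s => rfl
  have hLL₀ : L + L₀ = J.val.map qf := by
    rw [← Multiset.map_add, Finset.filter_val, Finset.filter_val, Multiset.filter_add_not]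
  -- the index multiset splits as `t₀ ::ₘ (J + (univ ∖ I))`
  have hdisj : Disjoint J ((Finset.univ : Finset σ) \ I) :=
    Finset.disjoint_left.mpr fun s hs hs' => (Finset.mem_sdiff.mp hs').2 (Finset.mem_of_mem_erase hs)
  have hunion : J.disjUnion ((Finset.univ : Finset σ) \ I) hdisj = Finset.univ.erase t₀ := by
    ext s
    rw [Finset.disjUnion_eq_union, Finset.mem_union, Finset.mem_erase, Finset.mem_sdiff,
      Finset.mem_erase]
    constructor
    · rintro (⟨hst, -⟩ | ⟨-, hsI⟩)
      · exact ⟨hst, Finset.mem_univ _⟩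
      · exact ⟨fun h => hsI (h ▸ ht₀), Finset.mem_univ _⟩
    · rintro ⟨hst, -⟩
      by_cases hsI : s ∈ I
      · exact Or.inl ⟨hst, hsI⟩
      · exact Or.inr ⟨Finset.mem_univ _, hsI⟩
  have huniv : (Finset.univ : Finset σ).val = t₀ ::ₘ (J.val + ((Finset.univ : Finset σ) \ I).val) := by
    have hval : ((Finset.univ : Finset σ).erase t₀).val = J.val + ((Finset.univ : Finset σ) \ I).val := by
      rw [← hunion]; rfl
    rw [← hval, Finset.erase_val, Multiset.cons_erase (Finset.mem_univ_val t₀)]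
  refine ⟨L.map (fun q => triad q.1.1 q.1.2.1 (q.1.2.2 + (q.2.1 * q.2.2) • v t₀)) + R,
    ⟨w t₀, u t₀, v t₀, R, L, L₀, ?_, ?_, ?_, ?_, rfl⟩, ?_, ?_⟩
  · -- `S = T_{t₀} ::ₘ ((L + L₀).map tr + R)`
    rw [hLL₀, Multiset.map_map, huniv, Multiset.map_cons, Multiset.map_add]
    rfl
  · -- `A^{(t₀)} = αᵢ A^{(i)}`
    intro q hq
    rw [hLL₀, Multiset.mem_map] at hq
    obtain ⟨s, hs, rfl⟩ := hq
    exact (hα s (Finset.mem_of_mem_erase (Finset.mem_val.mp hs))).symm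
  · -- `B^{(t₀)} = Σ βᵢ B^{(i)}`
    rw [hLL₀, Multiset.map_map, hut]
    rfl
  · -- the dropped elements vanish
    intro q hq
    obtain ⟨s, hs, rfl⟩ := Multiset.mem_map.mp hq
    rw [Finset.mem_val, Finset.mem_filter] at hs
    rw [hmdq]
    by_contra h
    exact hs.2 h
  · -- all elements of `S'` are non-zero
    intro T hT
    rcases Multiset.mem_add.mp hT with hT | hT
    · obtain ⟨q, hq, rfl⟩ := Multiset.mem_map.mp hT
      obtain ⟨s, hs, rfl⟩ := Multiset.mem_map.mp hq
      rw [Finset.mem_val, Finset.mem_filter] at hs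
      rw [hmdq]
      exact hs.2
    · obtain ⟨s, -, rfl⟩ := Multiset.mem_map.mp hT
      exact h0 s
  · -- … and rank-one
    intro T hT
    rcases Multiset.mem_add.mp hT with hT | hT
    · obtain ⟨q, -, rfl⟩ := Multiset.mem_map.mp hT
      exact ⟨_, _, _, rfl⟩
    · obtain ⟨s, -, rfl⟩ := Multiset.mem_map.mp hT
      exact ⟨_, _, _, rfl⟩

/-- Transport of the core along a slot permutation `π` with inverse `πi` (bookkeeping). [folklore] -/
private theorem transport_nonzero_triads {ι' κ' μ' : Type*}
    (π : (ι → κ → μ → K) → (ι' → κ' → μ' → K)) (πi : (ι' → κ' → μ' → K) → (ι → κ → μ → K))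
    (hππ : ∀ U, π (πi U) = U) (hπ0 : π 0 = 0)
    (htri : ∀ (a : ι' → K) (b : κ' → K) (c : μ' → K),
      ∃ (a' : ι → K) (b' : κ → K) (c' : μ → K), πi (triad a b c) = triad a' b' c')
    {S₁ : Multiset (ι' → κ' → μ' → K)} (hne : ∀ U ∈ S₁, U ≠ 0)
    (htr : ∀ U ∈ S₁, ∃ (a : ι' → K) (b : κ' → K) (c : μ' → K), U = triad a b c) :
    (S₁.map πi).map π = S₁ ∧ (∀ T ∈ S₁.map πi, T ≠ 0) ∧
      (∀ T ∈ S₁.map πi, ∃ (a : ι → K) (b : κ → K) (c : μ → K), T = triad a b c) := by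
  refine ⟨?_, fun T hT => ?_, fun T hT => ?_⟩
  · rw [Multiset.map_map]
    conv_rhs => rw [← Multiset.map_id S₁]
    exact Multiset.map_congr rfl fun U _ => hππ U
  · obtain ⟨U, hU, rfl⟩ := Multiset.mem_map.mp hT
    intro h
    exact hne U hU (by rw [← hππ U, h, hπ0])
  · obtain ⟨U, hU, rfl⟩ := Multiset.mem_map.mp hT
    obtain ⟨a, b, c, rfl⟩ := htr U hU
    exact htri a b c

/-- **KM Prop. 3 as an edge of the flip graph.** If a scheme `S` is reducible in the sense of Def. 2
— for some presentation `S = {w s ⊗ u s ⊗ v s}_s` the family is `Reducible` (any of the six cases) —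
then `S` has a reduction `S'` which is again a scheme of `t`: an `E₂`-edge `S → S'` to a lower level
(`Reduces.card_lt`). [cite: KauersMoosbauer2022FlipGraphs, Prop. 3] -/
theorem exists_reduces_of_reducible {t : ι → κ → μ → K} (x : Scheme t) {σ : Type*} [Fintype σ]
    [DecidableEq σ] (w : σ → ι → K) (u : σ → κ → K) (v : σ → μ → K)
    (hx : x.elts = (Finset.univ : Finset σ).val.map fun s => triad (w s) (u s) (v s))
    (hred : Reducible w u v) :
    ∃ y : Scheme t, Reduces x.elts y.elts := by
  have h0 : ∀ s, triad (w s) (u s) (v s) ≠ 0 := fun s =>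
    x.ne_zero _ (by rw [hx]; exact Multiset.mem_map_of_mem _ (Finset.mem_univ_val s))
  -- the six cases of Def. 2: the core applied to the slot-permuted family, transported back
  -- a scheme from a reduction with non-zero rank-one elements
  have mk : ∀ S' : Multiset (ι → κ → μ → K), Reduces x.elts S' → (∀ T ∈ S', T ≠ 0) →
      (∀ T ∈ S', ∃ (a : ι → K) (b : κ → K) (c : μ → K), T = triad a b c) →
      ∃ y : Scheme t, Reduces x.elts y.elts := fun S' hR hne htr =>
    ⟨⟨S', hne, htr, by rw [hR.sum_eq, x.sum_eq]⟩, hR⟩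
  obtain ⟨I, -, hI⟩ := hred
  rcases hI with ⟨h1, h2 | h2⟩ | ⟨h1, h2 | h2⟩ | ⟨h1, h2 | h2⟩
  · -- `A, B`
    obtain ⟨S', hRB, hne, htr⟩ := exists_redBase_of_caseAB w u v h0 I h1 h2
    exact mk S' (Or.inl (hx ▸ hRB)) hne htr
  · -- `A, Γ`: family `(w, v, u)`, transport `sw₂₃`
    have h0' : ∀ s, triad (w s) (v s) (u s) ≠ 0 := fun s => by
      obtain ⟨ha, hb, hc⟩ := factors_ne_zero (h0 s)
      rw [Ne, triad_eq_zero_iff]; push Not; exact ⟨ha, hc, hb⟩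
    obtain ⟨S₁, hRB, hne, htr⟩ := exists_redBase_of_caseAB w v u h0' I h1 h2
    obtain ⟨hmap, hne', htr'⟩ := transport_nonzero_triads (ι := ι) (κ := κ) (μ := μ) sw₂₃ sw₂₃
      (fun _ => rfl) rfl (fun a b c => ⟨a, c, b, sw₂₃_triad a b c⟩) hne htr
    refine mk _ (Or.inr (Or.inl ?_)) hne' htr'
    have hS : x.elts.map sw₂₃ = (Finset.univ : Finset σ).val.map fun s => triad (w s) (v s) (u s) := by
      rw [hx, Multiset.map_map]; exact Multiset.map_congr rfl fun s _ => sw₂₃_triad _ _ _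
    rw [hS, hmap]; exact hRB
  · -- `B, A`: family `(u, w, v)`, transport `sw₁₂`
    have h0' : ∀ s, triad (u s) (w s) (v s) ≠ 0 := fun s => by
      obtain ⟨ha, hb, hc⟩ := factors_ne_zero (h0 s)
      rw [Ne, triad_eq_zero_iff]; push Not; exact ⟨hb, ha, hc⟩
    obtain ⟨S₁, hRB, hne, htr⟩ := exists_redBase_of_caseAB u w v h0' I h1 h2
    obtain ⟨hmap, hne', htr'⟩ := transport_nonzero_triads (ι := ι) (κ := κ) (μ := μ) sw₁₂ sw₁₂
      (fun _ => rfl) rfl (fun a b c => ⟨b, a, c, sw₁₂_triad a b c⟩) hne htr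
    refine mk _ (Or.inr (Or.inr (Or.inl ?_))) hne' htr'
    have hS : x.elts.map sw₁₂ = (Finset.univ : Finset σ).val.map fun s => triad (u s) (w s) (v s) := by
      rw [hx, Multiset.map_map]; exact Multiset.map_congr rfl fun s _ => sw₁₂_triad _ _ _
    rw [hS, hmap]; exact hRB
  · -- `B, Γ`: family `(u, v, w)`, transport `cyc`
    have h0' : ∀ s, triad (u s) (v s) (w s) ≠ 0 := fun s => by
      obtain ⟨ha, hb, hc⟩ := factors_ne_zero (h0 s)
      rw [Ne, triad_eq_zero_iff]; push Not; exact ⟨hb, hc, ha⟩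
    obtain ⟨S₁, hRB, hne, htr⟩ := exists_redBase_of_caseAB u v w h0' I h1 h2
    obtain ⟨hmap, hne', htr'⟩ := transport_nonzero_triads (ι := ι) (κ := κ) (μ := μ) cyc cyc₂
      (fun _ => rfl) rfl (fun a b c => ⟨c, a, b, cyc₂_triad a b c⟩) hne htr
    refine mk _ (Or.inr (Or.inr (Or.inr (Or.inl ?_)))) hne' htr'
    have hS : x.elts.map cyc = (Finset.univ : Finset σ).val.map fun s => triad (u s) (v s) (w s) := by
      rw [hx, Multiset.map_map]; exact Multiset.map_congr rfl fun s _ => cyc_triad _ _ _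
    rw [hS, hmap]; exact hRB
  · -- `Γ, A`: family `(v, w, u)`, transport `cyc₂`
    have h0' : ∀ s, triad (v s) (w s) (u s) ≠ 0 := fun s => by
      obtain ⟨ha, hb, hc⟩ := factors_ne_zero (h0 s)
      rw [Ne, triad_eq_zero_iff]; push Not; exact ⟨hc, ha, hb⟩
    obtain ⟨S₁, hRB, hne, htr⟩ := exists_redBase_of_caseAB v w u h0' I h1 h2
    obtain ⟨hmap, hne', htr'⟩ := transport_nonzero_triads (ι := ι) (κ := κ) (μ := μ) cyc₂ cyc
      (fun _ => rfl) rfl (fun a b c => ⟨b, c, a, cyc_triad a b c⟩) hne htr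
    refine mk _ (Or.inr (Or.inr (Or.inr (Or.inr (Or.inl ?_))))) hne' htr'
    have hS : x.elts.map cyc₂ = (Finset.univ : Finset σ).val.map fun s => triad (v s) (w s) (u s) := by
      rw [hx, Multiset.map_map]; exact Multiset.map_congr rfl fun s _ => cyc₂_triad _ _ _
    rw [hS, hmap]; exact hRB
  · -- `Γ, B`: family `(v, u, w)`, transport `sw₁₃`
    have h0' : ∀ s, triad (v s) (u s) (w s) ≠ 0 := fun s => by
      obtain ⟨ha, hb, hc⟩ := factors_ne_zero (h0 s)
      rw [Ne, triad_eq_zero_iff]; push Not; exact ⟨hc, hb, ha⟩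
    obtain ⟨S₁, hRB, hne, htr⟩ := exists_redBase_of_caseAB v u w h0' I h1 h2
    obtain ⟨hmap, hne', htr'⟩ := transport_nonzero_triads (ι := ι) (κ := κ) (μ := μ) sw₁₃ sw₁₃
      (fun _ => rfl) rfl (fun a b c => ⟨c, b, a, sw₁₃_triad a b c⟩) hne htr
    refine mk _ (Or.inr (Or.inr (Or.inr (Or.inr (Or.inr ?_))))) hne' htr'
    have hS : x.elts.map sw₁₃ = (Finset.univ : Finset σ).val.map fun s => triad (v s) (u s) (w s) := by
      rw [hx, Multiset.map_map]; exact Multiset.map_congr rfl fun s _ => sw₁₃_triad _ _ _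
    rw [hS, hmap]; exact hRB

/-- In particular a reducible scheme is adjacent (by an `E₂`-edge) to a scheme of smaller rank —
"a reduction always leads to a vertex belonging to a lower level".
[cite: KauersMoosbauer2022FlipGraphs, Prop. 3 and Def. 8] -/
theorem exists_adj_rank_lt_of_reducible {t : ι → κ → μ → K} (x : Scheme t) {σ : Type*}
    [Fintype σ] [DecidableEq σ] (w : σ → ι → K) (u : σ → κ → K) (v : σ → μ → K)
    (hx : x.elts = (Finset.univ : Finset σ).val.map fun s => triad (w s) (u s) (v s))
    (hred : Reducible w u v) :
    ∃ y : Scheme t, Adj x y ∧ y.rank < x.rank := by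
  obtain ⟨y, hy⟩ := exists_reduces_of_reducible x w u v hx hred
  exact ⟨y, Or.inr hy, hy.card_lt⟩

end ReducibleEdge

/-! ## §9 Flips are reversible (KM §3) -/

section Reversible

variable {K : Type*} [CommRing K] {ι κ μ : Type*}

/-- `a ⊗ (b' − b) ⊗ c = a ⊗ b' ⊗ c − a ⊗ b ⊗ c`. [folklore] -/
private theorem triad_sub_mid (a : ι → K) (b b' : κ → K) (c : μ → K) :
    triad a (b' - b) c = triad a b' c - triad a b c := by
  funext x y z; simp only [triad_apply, Pi.sub_apply]; ring

/-- `a ⊗ b ⊗ (c' − c) = a ⊗ b ⊗ c' − a ⊗ b ⊗ c`. [folklore] -/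
private theorem triad_sub_right (a : ι → K) (b : κ → K) (c c' : μ → K) :
    triad a b (c' - c) = triad a b c' - triad a b c := by
  funext x y z; simp only [triad_apply, Pi.sub_apply]; ring

/-- **"Note that flips are reversible because if `S' = (S ∖ {T₁,T₂}) ∪ {T₁+T, T₂−T}`, then
`S = (S' ∖ {T₂−T, T₁+T}) ∪ {(T₂−T)+T, (T₁+T)−T}`"** — the written case of Def. 4: the reverse of
a flip sharing the first factor is a flip sharing the first factor (with the pair `(T₂−T, T₁+T)`
and the same `T`, which is of the other admissible kind for that pair).
[cite: KauersMoosbauer2022FlipGraphs, §3 (remark after Def. 4)] -/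
theorem FlipBase.symm {S S' : Multiset (ι → κ → μ → K)} (h : FlipBase S S') : FlipBase S' S := by
  obtain ⟨a, b, b', c, c', R, hS, hS'⟩ := h
  rcases hS' with hS' | hS'
  · -- `T = a⊗b⊗c'`: `S' = {a⊗b⊗(c+c'), a⊗(b'−b)⊗c'} ∪ R`; reverse with the pair
    -- `(a⊗(b'−b)⊗c', a⊗b⊗(c+c'))` and `T = a⊗b⊗c'` (second kind).
    refine ⟨a, b' - b, b, c', c + c', R, ?_, Or.inr ?_⟩
    · rw [hS', Multiset.cons_swap, triad_sub_mid, triad_add_right]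
    · rw [hS, Multiset.cons_swap, triad_sub_mid, triad_add_right]
      congr 1
      · rw [sub_add_cancel]
      · rw [add_sub_cancel_right]
  · -- `T = a⊗b'⊗c`: `S' = {a⊗(b+b')⊗c, a⊗b'⊗(c'−c)} ∪ R`; reverse with the pair
    -- `(a⊗b'⊗(c'−c), a⊗(b+b')⊗c)` and `T = a⊗b'⊗c` (first kind).
    refine ⟨a, b', b + b', c' - c, c, R, ?_, Or.inl ?_⟩
    · rw [hS', Multiset.cons_swap, triad_sub_right, triad_add_mid]
    · rw [hS, Multiset.cons_swap, triad_sub_right, triad_add_mid]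
      congr 1
      · rw [sub_add_cancel]
      · rw [add_sub_cancel_right]

/-- **Flips are reversible** (all three cases of Def. 4): if `S'` is a flip of `S`, then `S` is a
flip of `S'` — `E₁` is a symmetric relation.
[cite: KauersMoosbauer2022FlipGraphs, §3 (remark after Def. 4)] -/
theorem Flips.symm {S S' : Multiset (ι → κ → μ → K)} (h : Flips S S') : Flips S' S := by
  rcases h with h | h | h
  · exact Or.inl h.symm
  · exact Or.inr (Or.inl h.symm)
  · exact Or.inr (Or.inr h.symm)

/-- `S'` is a flip of `S` iff `S` is a flip of `S'`.
[cite: KauersMoosbauer2022FlipGraphs, §3 (remark after Def. 4)] -/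
theorem flips_comm (S S' : Multiset (ι → κ → μ → K)) : Flips S S' ↔ Flips S' S :=
  ⟨Flips.symm, Flips.symm⟩

end Reversible

end FlipGraph

end Literature.Computability.AlgebraicComplexity
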